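import Mathlib
import Literature.MathematicalPhysics.QuantumFieldTheory.Balaban1983to89.B9SectDSup

/-!
# `Balaban1983to89.B9SectDWalk` — [Balaban1985BackgroundPropagators] Sect. D, Theorem 3.12 p. 423 ("Theorem 3.10
holds for G, G₁"): the GENERALIZED RANDOM-WALK EXPANSION of the Sect.-D propagators obtained by *"replacing each
operator in (3.130) by its random walk expansion"* (p. 422), KERNEL-CHECKED as an algebra of WALKS OF WALK TERMS over
abstract block norms — per-term bound of the (3.108) shape with the concatenated walk distance (3.93), summability of
the whole family WITHOUT counting walks, convergence, and the limit bound of the Theorem 3.12 shape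

CITATION HEADER (lean-in-tree rule 2026-08-18).  Source under reading: T. Bałaban, *Propagators for lattice gauge
theories in a background field*, Commun. Math. Phys. **99**, 389–434 (1985), doi:10.1007/bf01240355
[`Balaban1985BackgroundPropagators`] (cell paper B9; held `paper:balaban1985-cmp99-background-propagators`; journal
page = PDF page + 388; every quotation below is read from the page renders
`b2b-balaban-ref1/pages/1985-cmp99-background-propagators/…-p022,p028,p033,p034,p035-x2.png`), and T. Bałaban,
*Propagators and renormalization transformations for lattice gauge theories. II*, Commun. Math. Phys. **96**, 223–250
(1984) [`Balaban1984PropagatorsII`] (cell paper B6 = ref. [4] of B9), (2.54) p. 233 and Lemma 2.1 p. 234.  PRINTED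
INPUTS (theorem STATEMENTS only, never the disputed steps).  Theorem 3.10 p. 416: *"operator G has the expansion
G = Σ_ω R₀(X₀)R_{α₁}(X₁)·…·R_{αₙ}(Xₙ), (3.107) the sum is over walks ω = ((0,X₀),(α₁,X₁),…,(αₙ,Xₙ)) satisfying
X_{i−1} ∩ X_i ≠ ∅, i = 1,…,n. A term in this expansion, corresponding to a walk ω, depends on configuration U
restricted to X̃₀⁵ ∪ X̃₁⁵ ∪ … ∪ X̃ₙ⁵, satisfies the inequality |(R₀(X₀)R_{α₁}(X₁)·…·R_{αₙ}(Xₙ)J)(x)| ≤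
O(1)(L^jη)²O(M^{−1/2})^{|ω|}·M^{−½|ω|}e^{−½δ₀d(ω,y,y′)}|J|, x ∈ Δ(y), y ∈ Λ_j, supp J ⊂ Δ(y′), (3.108) and the
corresponding inequalities for norms on the left-hand sides of (3.42)–(3.47). The constant O(1) depends on d and L
only. From (3.108) it follows that the expansion (3.107) is convergent in all norms in the inequalities
(3.42)–(3.47). This implies Theorem 3.3."*; (3.93) p. 410: *"We use part of the exponentials to control the sum over
yᵢ's, let us say the exponentials with ½δ₀ instead of δ₀, the remaining are used to construct an overall exponential
factor. Let us define a distance relative to the walk ω by d(ω,y,y′) = inf_{(y₁,…,yₙ)}(d(y,y₁) + d(y₁,y₂) + ⋯ +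
d(y_{n−1},yₙ) + d(yₙ,y′)), (3.93) the infimum is taken over all sequences (y₁,y₂,…,yₙ) of points yᵢ ∈ □ᵢ ∈ 𝔅. Let
us denote |ω| = n."*; Corollary 3.8 p. 410 (3.94) and *"Similar estimates hold for the other norms. We will use the
factor O(M^{−1/2}) to control the sum over random walks ω, and the last two factors in (3.94) will be important for
other purposes."*; (3.130) p. 421: *"G = G₀(I − Δ′_πG₀)⁻¹ = Σ_{n=0}^∞ G₀(Δ′_πG₀)ⁿ. (3.130)"*; p. 422 (after
(3.131)), THE WHOLE PRINTED WARRANT for the object of this module: *"Of course Theorem 3.10 holds also because we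
replace each operator in (3.130) by its random walk expansion. We do not have problems now with operators without
small factors, because each operator Δ′_π provides the small factor α₀, which we can choose to be arbitrarily small.
The operators (QGQ*)⁻¹, or (QG₁Q*)⁻¹, can be analyzed in the same way as the operator (Q′G′²Q′*)⁻¹. We will not
repeat these considerations here, let us write only bounds."*; Theorem 3.12 p. 423: *"If an external gauge field
configuration U satisfies both regularity conditions (3.35), (3.36) for α₀ sufficiently small, then Theorems 3.3,
3.10, 3.11 hold for the propagators G, G₁, with one exception and the inequality (1.133) together with Theorem 3.10
hold for the operators H, H₁. The exception is the inequality in (3.42) involving the covariant Laplace operator. It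
does not hold for G, G₁."* ([sic] "(1.133)" = (3.133), cell flag F-1.133); [4] (2.54) (`B6RandomWalk.Triangle254`)
and Lemma 2.1 (2.61) (`B11SectG.RowSum`).

WHAT IS REPRODUCED.  The LOCATED GAP (cell GAPS G-B9-16 residual (4) / G-pv21g2-1 (a)): Theorem 3.12 asserts
Theorem 3.10 — an expansion of the (3.107) SHAPE with per-term bounds of the (3.108) SHAPE, U-localization of the
terms, and convergence in the norms of (3.42)–(3.47) — for G = Σ_n G₀(Δ′_πG₀)ⁿ and G₁ ((3.138)), with the single
sentence of p. 422 as proof.  Substituting the printed expansions of the factors (G₀: Thm 3.10; G′ inside Δ′_π: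
(3.90)/(3.94); (Q′G′²Q′*)⁻¹ inside P: (3.98)–(3.99)) into (3.130) produces terms that are CHAINS of products of
walk terms applied to a seed walk term, indexed by (Neumann order, one pair of factor walks per step, a seed walk).
THIS MODULE kernel-checks, over ABSTRACT block-normed spaces (`B11SectG.BlockNorm`, `HasMaj`) and in the FACTORED
form G₀Δ′_π = 𝒢∘𝒯 of the sibling `B9SectDSup` (the only form in which the sup/Hölder bookkeeping closes, cell GAPS
C-pv21g2-1), everything in that sentence which is bookkeeping: (a) WALK DISTANCES (§1): domination d ≤ D (`DomBy`),
passage through a localization (`Through`, the content of (3.93) used on p. 427), the inf-convolution D₁ □ D₂ of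
(3.93) for concatenated walks (`infConv`; `domBy_infConv` from (2.54); `through_infConv_left/right`), the elementary
distance of a factor localized in X (`passDist`); (b) THE MECHANISM (3.92)→(3.94) (§2): Σ_{y″}e^{−δD₁(y,y″)}
e^{−ρD₂(y″,y′)} ≤ c·e^{−ρ(D₁□D₂)(y,y′)} for ρ + σ ≤ δ (`conv_walk_le`, mirror form `conv_walk_le_mirror` under
`DistSymm`) — the row sum (2.61) is paid from the EXCESS rate of one factor, the rate ρ is carried undiminished onto
the concatenated walk distance — and the composition rule for walk terms (`hasMaj_comp_walk(_mirror)`); (c) CHAINS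
(§3): the operator, constant and distance of a list of steps over a seed (`chainOp`, `chainConst`, `chainDist`) and the
PER-TERM BOUND `chain_majorant`: steps θᵢe^{−δDᵢ}, seed Ae^{−ρD_S}, ρ + σ ≤ δ ⇒ majorant A·Π(κθᵢc)·e^{−ρD_chain}
(`chainConst_le_pow`: ≤ A(κθ̄c)^{n}, the geometric factor of (3.108) in the number of steps; `through_chainDist_mem`:
D_chain passes through every localization any step visits); (d) SUMMABILITY WITHOUT COUNTING (§4–§5): uniformly
bounded partial sums of a majorant family (`MajSumLe`) are preserved under concatenation (`MajSumLe.prod`, via the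
bilinearity of the convolution `conv`) and under the Neumann series (`neumann_majSumLe`: step family summing to
≤ θ̄e^{−δd}, seed family to ≤ Ae^{−ρ_Sd}, q = κθ̄c < 1 ⇒ every finite set of (chain, seed) terms has iterated majorants
summing to ≤ A(1 − q)⁻¹e^{−ρd}; ingredients `lists`/`sum_lists_chainMaj` (multilinearity over all chains of a given
length) and the geometric series) — this is the typed content of *"each operator Δ′_π provides the small factor α₀"*:
θ̄ ∝ the small factor, and NO bound on the number of walks is needed; (e) THE EXPANSION AS OPERATORS (§5): the
truncated expansion `truncExp` (Neumann order < N, step terms in I, seed terms in S₀) equals Σ_{n<N}(Σ_{I}Kᵢ)ⁿ∘(Σ_{S₀}S_ω)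
(`truncExp_eq`, distributivity) and has the majorant A(1 − q)⁻¹e^{−ρd} uniformly in (N, I, S₀) (`truncExp_majorant`);
(f) CONVERGENCE (§6): in the block seminorms (`CvgTo`), limits inherit uniform majorants (`CvgTo.hasMaj_of_uniform` —
*"This implies Theorem 3.3"*), products / powers / Neumann partial sums of convergent truncations converge
(`CvgTo.comp`, `.pow`, `.neumannPartial`), and the Neumann remainder G − Σ_{n<N}𝒦ⁿS = 𝒦ᴺG has majorant qᴺM₀ → 0
(`neumann_remainder`, from `B11SectG.neumann_telescope`); (g) SECTION D (§7): steps 𝒢_γ𝒯_τ (`stepOp`) — THEOREM W of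
the companion md: (i) `sectD_term_majorant` (the (3.108)-shape bound of every term, rates ρ + σ ≤ δ ≤ δ_T, δ + σ ≤ δ_G),
(i′) `sectD_term_through` (where the decay lives), (ii) `sectD_truncExp_majorant` (uniform majorant Ā(1 − q)⁻¹e^{−ρ′d},
q = κ_F(κ_P B̄C̄c)c), (iii) `sectD_step_cvg`, (iv) `sectD_limit_majorant` (convergence to Σ_{n<N}𝒦ⁿ𝒮, the remainder,
and the Theorem-3.12-shape majorant of G recovered from the expansion).
CENSUS RESULT (with the md `HOME/b2b-balaban-r1/SectD-walk-proof.md`): GIVEN walk expansions of the printed shapes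
for G₀ (Thm 3.10 with "the corresponding inequalities" for the entries (3.42)₁,₃, (3.43)₂ — hypothesis, cell GAPS
G-B9-07), for G′ ((3.90)/(3.94) + "Similar estimates hold for the other norms") and for (Q′G′²Q′*)⁻¹ ((3.99)), the
Sect.-D propagators G and G₁ (mod (3.137)) have expansions of the (3.107) shape whose terms obey (3.108)-shape
bounds in the sup/Hölder entries with the concatenated walk distance, at the rates of THEOREM S ((½ − 4β)δ₀ for
the right entries, (½ − 5β)δ₀ two-sided; β ∈ (0, 1/40]), and whose partial sums are majorised UNIFORMLY by a bound
of the THEOREM S shape, under ONE smallness Mα₀ ≤ a_W of the same form as a_S (built from the SUMMED per-term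
constants of the factor expansions instead of B₀); NO walk-counting lemma is needed at the Sect.-D level (summability
is inherited multilinearly from the factors' printed convergence clauses); the literal per-step factor
"O(M^{−1/2})·M^{−1/2}" of (3.108) for the Δ′_π-steps requires the EXTRA located smallness Mα₀ ≤ O(1)M^{−1} (p. 422:
*"which we can choose to be arbitrarily small"*), recorded, not hidden.
WHAT IS *NOT* REPRODUCED OR ASSERTED: the walk expansions of G₀, G′, (Q′G′²Q′*)⁻¹ themselves (Theorems 3.7–3.10:
hypotheses of printed shape; their proofs are GAPS G-B9-07); the U-DEPENDENCE half of the localization clause (it is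
`B9Locality.Walk.term_dependsOnlyOn` / `IsLocalIn.mul`, cited by name in the md, not re-proved here); the lattice,
the concrete norms, the identity G₀Δ′_π = 𝒢𝒯 (sibling header); (3.42)₄; the L² entries (3.46) (sibling
`B9SectDL2Decay`); H, H₁, (QGQ*)⁻¹ / Theorem 3.13 (p. 422: "can be analyzed in the same way" — NOT done here; brief
for the next generation); the Dirichlet setting of Sect. D near ∂Ω₀ (a reading, md §8).  Infinite sums are never
formed: "convergence" is typed as uniform majorants of all finite truncations + convergence of truncations in every
block seminorm, which is what the consumers (B10 (23), B11 (117), B13) use.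
NOT used: any statement of the manuscripts under audit as a fact about their disputed steps; `Literature.Barriers`.
Companion cell records (not part of the tree): `HOME/b2b-balaban-r1/SectD-walk-proof.md` (THEOREM W, census), cell
`GAPS.md` G-B9-16R4 / C-r1g8-1, `INTERFACES-A.md` IF-A-31, unit `b2b-balaban-r1-g8`.
-/

namespace Literature.MathematicalPhysics.QuantumFieldTheory.Balaban1983to89.B9SectDWalk

open Literature.MathematicalPhysics.QuantumFieldTheory.Balaban1983to89
open Finset B6RandomWalk B11SectG B9SectDSup

variable {g : B6.Geometry}

/-! ## 1. Walk distances: domination of d, passage through a localization, inf-convolution ((3.93)) -/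

section WalkDist

variable (g) in
/-- A WALK DISTANCE dominates the multiscale distance d of [4] (2.46): d(y,y′) ≤ D(y,y′) — the property of
d(ω,y,y′) of (3.93) that survives every composition and is all the rate bookkeeping needs. [folklore] -/
def DomBy (D : g.Site → g.Site → ℝ) : Prop :=
  ∀ y y' : g.Site, g.dist y y' ≤ D y y'

variable (g) in
/-- The walk distance D PASSES THROUGH the set X: D(y,y′) ≥ d(y,z) + d(z,y′) for some z ∈ X — the content of (3.93)
(*"the infimum is taken over all sequences (y₁, y₂, …, yₙ) of points yᵢ ∈ □ᵢ ∈ 𝔅"*, p. 410) used in the proof of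
Theorem 3.14 (p. 427: a localization meeting Ωᶜ costs the factor (3.154)). [cite: Balaban1985BackgroundPropagators, (3.93) p.410] -/
def Through (D : g.Site → g.Site → ℝ) (X : Set g.Site) : Prop :=
  ∀ y y' : g.Site, ∃ z ∈ X, g.dist y z + g.dist z y' ≤ D y y'

/-- The INF-CONVOLUTION of two walk distances: (D₁ □ D₂)(y,y′) = inf_{y″}(D₁(y,y″) + D₂(y″,y′)) — the distance (3.93)
of a concatenated walk (the junction point y″ is the new intermediate point). [cite: Balaban1985BackgroundPropagators, (3.93) p.410] -/
noncomputable def infConv (D₁ D₂ : g.Site → g.Site → ℝ) (y y' : g.Site) : ℝ :=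
  (Finset.univ : Finset g.Site).inf' ⟨y, Finset.mem_univ y⟩ fun y'' => D₁ y y'' + D₂ y'' y'

/-- The inf-convolution is below every one-junction value. [folklore] -/
theorem infConv_le (D₁ D₂ : g.Site → g.Site → ℝ) (y y' y'' : g.Site) :
    infConv D₁ D₂ y y' ≤ D₁ y y'' + D₂ y'' y' :=
  Finset.inf'_le (fun y'' => D₁ y y'' + D₂ y'' y') (Finset.mem_univ y'')

/-- The infimum of the inf-convolution is attained (𝔅 finite). [folklore] -/
theorem exists_infConv_eq (D₁ D₂ : g.Site → g.Site → ℝ) (y y' : g.Site) :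
    ∃ y'' : g.Site, infConv D₁ D₂ y y' = D₁ y y'' + D₂ y'' y' := by
  obtain ⟨y'', -, h⟩ := Finset.exists_mem_eq_inf' (s := (Finset.univ : Finset g.Site))
    ⟨y, Finset.mem_univ y⟩ (fun y'' => D₁ y y'' + D₂ y'' y')
  exact ⟨y'', h⟩

/-- A lower bound of every one-junction value is a lower bound of the inf-convolution. [folklore] -/
theorem le_infConv {D₁ D₂ : g.Site → g.Site → ℝ} {y y' : g.Site} {a : ℝ}
    (h : ∀ y'' : g.Site, a ≤ D₁ y y'' + D₂ y'' y') : a ≤ infConv D₁ D₂ y y' :=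
  Finset.le_inf' _ _ fun y'' _ => h y''

/-- d itself is a walk distance (walks of length 0). [folklore] -/
theorem domBy_dist : DomBy g g.dist := fun _ _ => le_rfl

/-- Domination passes to larger functions. [folklore] -/
theorem DomBy.mono {D D' : g.Site → g.Site → ℝ} (h : DomBy g D) (hle : ∀ y y', D y y' ≤ D' y y') :
    DomBy g D' :=
  fun y y' => (h y y').trans (hle y y')

/-- A dominating walk distance is non-negative when d is. [folklore] -/
theorem DomBy.nonneg {D : g.Site → g.Site → ℝ} (hd : ∀ a b : g.Site, 0 ≤ g.dist a b) (h : DomBy g D)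
    (y y' : g.Site) : 0 ≤ D y y' :=
  (hd y y').trans (h y y')

/-- (2.54) ⇒ the concatenated distance still dominates d. [cite: Balaban1984PropagatorsII, (2.54) p.233] -/
theorem domBy_infConv (htri : Triangle254 g) {D₁ D₂ : g.Site → g.Site → ℝ} (h₁ : DomBy g D₁)
    (h₂ : DomBy g D₂) : DomBy g (infConv D₁ D₂) :=
  fun y y' => le_infConv fun y'' => (htri y y'' y').trans (add_le_add (h₁ y y'') (h₂ y'' y'))

/-- Passage through X survives concatenation, X visited by the LEFT factor. [cite: Balaban1985BackgroundPropagators, (3.93) p.410] -/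
theorem through_infConv_left (htri : Triangle254 g) {D₁ D₂ : g.Site → g.Site → ℝ} {X : Set g.Site}
    (h₁ : Through g D₁ X) (h₂ : DomBy g D₂) : Through g (infConv D₁ D₂) X := by
  intro y y'
  obtain ⟨y'', hy''⟩ := exists_infConv_eq D₁ D₂ y y'
  obtain ⟨z, hz, hzle⟩ := h₁ y y''
  refine ⟨z, hz, ?_⟩
  have h3 := htri z y'' y'
  have h4 := h₂ y'' y'
  rw [hy'']
  linarith

/-- Passage through X survives concatenation, X visited by the RIGHT factor. [cite: Balaban1985BackgroundPropagators, (3.93) p.410] -/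
theorem through_infConv_right (htri : Triangle254 g) {D₁ D₂ : g.Site → g.Site → ℝ} {X : Set g.Site}
    (h₁ : DomBy g D₁) (h₂ : Through g D₂ X) : Through g (infConv D₁ D₂) X := by
  intro y y'
  obtain ⟨y'', hy''⟩ := exists_infConv_eq D₁ D₂ y y'
  obtain ⟨z, hz, hzle⟩ := h₂ y'' y'
  refine ⟨z, hz, ?_⟩
  have h3 := htri y y'' z
  have h4 := h₁ y y''
  rw [hy'']
  linarith

/-- The elementary walk distance of a factor LOCALISED IN the (finite, non-empty) set X: D_X(y,y′) =
inf_{z∈X}(d(y,z) + d(z,y′)) — one intermediate point, (3.93) with n = 1. [cite: Balaban1985BackgroundPropagators, (3.93) p.410] -/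
noncomputable def passDist (X : Finset g.Site) (hX : X.Nonempty) (y y' : g.Site) : ℝ :=
  X.inf' hX fun z => g.dist y z + g.dist z y'

/-- D_X is below every passage value through a point of X. [folklore] -/
theorem passDist_le {X : Finset g.Site} (hX : X.Nonempty) {z : g.Site} (hz : z ∈ X) (y y' : g.Site) :
    passDist X hX y y' ≤ g.dist y z + g.dist z y' :=
  Finset.inf'_le (fun z => g.dist y z + g.dist z y') hz

/-- D_X dominates d ((2.54)). [cite: Balaban1984PropagatorsII, (2.54) p.233] -/
theorem domBy_passDist (htri : Triangle254 g) (X : Finset g.Site) (hX : X.Nonempty) :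
    DomBy g (passDist X hX) :=
  fun y y' => Finset.le_inf' _ _ fun z _ => htri y z y'

/-- D_X passes through X. [cite: Balaban1985BackgroundPropagators, (3.93) p.410] -/
theorem through_passDist (X : Finset g.Site) (hX : X.Nonempty) :
    Through g (passDist X hX) (↑X : Set g.Site) := by
  intro y y'
  obtain ⟨z, hz, h⟩ := Finset.exists_mem_eq_inf' hX (fun z => g.dist y z + g.dist z y')
  exact ⟨z, Finset.mem_coe.mpr hz, by rw [passDist, h]⟩

/-- What passage through X buys (the metric step of Theorem 3.14, p. 427): e^{−ρD(y,y′)} ≤ e^{−ρ(d(y,z)+d(z,y′))}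
for some z ∈ X. [cite: Balaban1985BackgroundPropagators, (3.154) p.427] -/
theorem Through.exp_le {D : g.Site → g.Site → ℝ} {X : Set g.Site} (h : Through g D X) {ρ : ℝ} (hρ : 0 ≤ ρ)
    (y y' : g.Site) :
    ∃ z ∈ X, Real.exp (-(ρ * D y y')) ≤ Real.exp (-(ρ * (g.dist y z + g.dist z y'))) := by
  obtain ⟨z, hz, hle⟩ := h y y'
  exact ⟨z, hz, Real.exp_le_exp.mpr (by nlinarith)⟩

end WalkDist

/-! ## 2. The mechanism of (3.92) → (3.94): convolution of exponentials of walk distances — the row sum is spent on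
the excess rate of ONE factor, the other rate is carried onto the concatenated walk distance (no cumulative loss) -/

section Conv

/-- Σ_{y″} e^{−δD₁(y,y″)}e^{−ρD₂(y″,y′)} ≤ c·e^{−ρ(D₁□D₂)(y,y′)} whenever ρ + σ ≤ δ, σ ≥ 0, D₁ ≥ d and the row sum (2.61)
holds at rate σ: *"We use part of the exponentials to control the sum over yᵢ's, let us say the exponentials with
½δ₀ instead of δ₀, the remaining are used to construct an overall exponential factor"* (p. 410) — here the "part" is
the excess δ − ρ ≥ σ of the LEFT factor.
[cite: Balaban1985BackgroundPropagators, (3.92)–(3.94) p.410; Balaban1984PropagatorsII, (2.61) p.234] -/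
theorem conv_walk_le {D₁ D₂ : g.Site → g.Site → ℝ} {δ ρ σ c : ℝ} (hd : ∀ a b : g.Site, 0 ≤ g.dist a b)
    (hrow : RowSum g σ c) (hσ : 0 ≤ σ) (hρ : 0 ≤ ρ) (hρδ : ρ + σ ≤ δ) (hD₁ : DomBy g D₁) (y y' : g.Site) :
    ∑ y'' : g.Site, Real.exp (-(δ * D₁ y y'')) * Real.exp (-(ρ * D₂ y'' y')) ≤
      c * Real.exp (-(ρ * infConv D₁ D₂ y y')) := by
  have hterm : ∀ y'' : g.Site, Real.exp (-(δ * D₁ y y'')) * Real.exp (-(ρ * D₂ y'' y')) ≤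
      Real.exp (-(σ * g.dist y y'')) * Real.exp (-(ρ * infConv D₁ D₂ y y')) := by
    intro y''
    rw [← Real.exp_add, ← Real.exp_add]
    refine Real.exp_le_exp.mpr ?_
    have h1 : ρ * infConv D₁ D₂ y y' ≤ ρ * (D₁ y y'' + D₂ y'' y') :=
      mul_le_mul_of_nonneg_left (infConv_le D₁ D₂ y y' y'') hρ
    have hD := hD₁ y y''
    have hdnn := hd y y''
    have h2 : σ * g.dist y y'' ≤ (δ - ρ) * D₁ y y'' :=
      calc σ * g.dist y y'' ≤ σ * D₁ y y'' := mul_le_mul_of_nonneg_left hD hσ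
        _ ≤ (δ - ρ) * D₁ y y'' := mul_le_mul_of_nonneg_right (by linarith) (hdnn.trans hD)
    nlinarith
  calc ∑ y'' : g.Site, Real.exp (-(δ * D₁ y y'')) * Real.exp (-(ρ * D₂ y'' y'))
      ≤ ∑ y'' : g.Site, Real.exp (-(σ * g.dist y y'')) * Real.exp (-(ρ * infConv D₁ D₂ y y')) :=
        Finset.sum_le_sum fun y'' _ => hterm y''
    _ = (∑ y'' : g.Site, Real.exp (-(σ * g.dist y y''))) * Real.exp (-(ρ * infConv D₁ D₂ y y')) := by
        rw [Finset.sum_mul]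
    _ ≤ c * Real.exp (-(ρ * infConv D₁ D₂ y y')) :=
        mul_le_mul_of_nonneg_right (hrow y) (Real.exp_nonneg _)

/-- The MIRROR form: the excess rate taken from the RIGHT factor (column sums, under the symmetry of d (2.46)).
[cite: Balaban1985BackgroundPropagators, (3.92)–(3.94) p.410; Balaban1984PropagatorsII, (2.61) p.234] -/
theorem conv_walk_le_mirror {D₁ D₂ : g.Site → g.Site → ℝ} {δ ρ σ c : ℝ} (hsym : DistSymm g)
    (hd : ∀ a b : g.Site, 0 ≤ g.dist a b) (hrow : RowSum g σ c) (hσ : 0 ≤ σ) (hρ : 0 ≤ ρ) (hρδ : ρ + σ ≤ δ)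
    (hD₂ : DomBy g D₂) (y y' : g.Site) :
    ∑ y'' : g.Site, Real.exp (-(ρ * D₁ y y'')) * Real.exp (-(δ * D₂ y'' y')) ≤
      c * Real.exp (-(ρ * infConv D₁ D₂ y y')) := by
  have hterm : ∀ y'' : g.Site, Real.exp (-(ρ * D₁ y y'')) * Real.exp (-(δ * D₂ y'' y')) ≤
      Real.exp (-(σ * g.dist y'' y')) * Real.exp (-(ρ * infConv D₁ D₂ y y')) := by
    intro y''
    rw [← Real.exp_add, ← Real.exp_add]
    refine Real.exp_le_exp.mpr ?_
    have h1 : ρ * infConv D₁ D₂ y y' ≤ ρ * (D₁ y y'' + D₂ y'' y') :=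
      mul_le_mul_of_nonneg_left (infConv_le D₁ D₂ y y' y'') hρ
    have hD := hD₂ y'' y'
    have hdnn := hd y'' y'
    have h2 : σ * g.dist y'' y' ≤ (δ - ρ) * D₂ y'' y' :=
      calc σ * g.dist y'' y' ≤ σ * D₂ y'' y' := mul_le_mul_of_nonneg_left hD hσ
        _ ≤ (δ - ρ) * D₂ y'' y' := mul_le_mul_of_nonneg_right (by linarith) (hdnn.trans hD)
    nlinarith
  calc ∑ y'' : g.Site, Real.exp (-(ρ * D₁ y y'')) * Real.exp (-(δ * D₂ y'' y'))
      ≤ ∑ y'' : g.Site, Real.exp (-(σ * g.dist y'' y')) * Real.exp (-(ρ * infConv D₁ D₂ y y')) :=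
        Finset.sum_le_sum fun y'' _ => hterm y''
    _ = (∑ y'' : g.Site, Real.exp (-(σ * g.dist y'' y'))) * Real.exp (-(ρ * infConv D₁ D₂ y y')) := by
        rw [Finset.sum_mul]
    _ ≤ c * Real.exp (-(ρ * infConv D₁ D₂ y y')) :=
        mul_le_mul_of_nonneg_right (colSum_of_rowSum hsym hrow y') (Real.exp_nonneg _)

variable {F₁ F₂ F₃ : Type} [AddCommGroup F₁] [Module ℝ F₁] [AddCommGroup F₂] [Module ℝ F₂]
  [AddCommGroup F₃] [Module ℝ F₃]

/-- **COMPOSITION OF WALK TERMS** (the term of a concatenated walk): T₁ (majorant a₁e^{−δD₁}, D₁ ≥ d) after T₂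
(majorant a₂e^{−ρD₂}) has majorant κ₂a₁a₂c·e^{−ρ(D₁□D₂)} for ρ + σ ≤ δ — the rate ρ is KEPT on the concatenated walk
distance; only the excess σ of the outer factor is spent on the junction sum ((2.61)).
[cite: Balaban1985BackgroundPropagators, (3.91)–(3.94) p.410; Balaban1984PropagatorsII, (2.52)–(2.56) pp.232–233] -/
theorem hasMaj_comp_walk {b₁ : BlockNorm g F₁} {b₂ : BlockNorm g F₂} {b₃ : BlockNorm g F₃}
    {T₁ : F₂ →ₗ[ℝ] F₃} {T₂ : F₁ →ₗ[ℝ] F₂} {D₁ D₂ : g.Site → g.Site → ℝ} {a₁ a₂ δ ρ σ c : ℝ}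
    (hd : ∀ a b : g.Site, 0 ≤ g.dist a b) (hrow : RowSum g σ c) (hσ : 0 ≤ σ)
    (ha₁ : 0 ≤ a₁) (ha₂ : 0 ≤ a₂) (hρ : 0 ≤ ρ) (hρδ : ρ + σ ≤ δ) (hD₁ : DomBy g D₁)
    (h₁ : HasMaj b₂ b₃ T₁ (fun a b => a₁ * Real.exp (-(δ * D₁ a b))))
    (h₂ : HasMaj b₁ b₂ T₂ (fun a b => a₂ * Real.exp (-(ρ * D₂ a b)))) :
    HasMaj b₁ b₃ (T₁ ∘ₗ T₂) (fun a b => b₂.κ * a₁ * a₂ * c * Real.exp (-(ρ * infConv D₁ D₂ a b))) := by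
  refine (hasMaj_comp h₁ h₂ fun a b => mul_nonneg ha₁ (Real.exp_nonneg _)).mono fun a b => ?_
  have hconv := conv_walk_le (D₂ := D₂) hd hrow hσ hρ hρδ hD₁ a b
  calc ∑ y'' : g.Site, a₁ * Real.exp (-(δ * D₁ a y'')) * (b₂.κ * (a₂ * Real.exp (-(ρ * D₂ y'' b))))
      = b₂.κ * a₁ * a₂ *
          ∑ y'' : g.Site, Real.exp (-(δ * D₁ a y'')) * Real.exp (-(ρ * D₂ y'' b)) := by
        rw [Finset.mul_sum]; exact Finset.sum_congr rfl fun y'' _ => by ring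
    _ ≤ b₂.κ * a₁ * a₂ * (c * Real.exp (-(ρ * infConv D₁ D₂ a b))) :=
        mul_le_mul_of_nonneg_left hconv (mul_nonneg (mul_nonneg b₂.κ_nonneg ha₁) ha₂)
    _ = _ := by ring

/-- Composition of walk terms, MIRROR form: the excess σ taken from the INNER factor (T₁ at rate ρ, T₂ at rate
δ ≥ ρ + σ with D₂ ≥ d; needs the symmetry of d). [cite: Balaban1985BackgroundPropagators, (3.91)–(3.94) p.410; Balaban1984PropagatorsII, (2.52)–(2.56) pp.232–233] -/
theorem hasMaj_comp_walk_mirror {b₁ : BlockNorm g F₁} {b₂ : BlockNorm g F₂} {b₃ : BlockNorm g F₃}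
    {T₁ : F₂ →ₗ[ℝ] F₃} {T₂ : F₁ →ₗ[ℝ] F₂} {D₁ D₂ : g.Site → g.Site → ℝ} {a₁ a₂ δ ρ σ c : ℝ}
    (hsym : DistSymm g) (hd : ∀ a b : g.Site, 0 ≤ g.dist a b) (hrow : RowSum g σ c) (hσ : 0 ≤ σ)
    (ha₁ : 0 ≤ a₁) (ha₂ : 0 ≤ a₂) (hρ : 0 ≤ ρ) (hρδ : ρ + σ ≤ δ) (hD₂ : DomBy g D₂)
    (h₁ : HasMaj b₂ b₃ T₁ (fun a b => a₁ * Real.exp (-(ρ * D₁ a b))))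
    (h₂ : HasMaj b₁ b₂ T₂ (fun a b => a₂ * Real.exp (-(δ * D₂ a b)))) :
    HasMaj b₁ b₃ (T₁ ∘ₗ T₂) (fun a b => b₂.κ * a₁ * a₂ * c * Real.exp (-(ρ * infConv D₁ D₂ a b))) := by
  refine (hasMaj_comp h₁ h₂ fun a b => mul_nonneg ha₁ (Real.exp_nonneg _)).mono fun a b => ?_
  have hconv := conv_walk_le_mirror (D₁ := D₁) hsym hd hrow hσ hρ hρδ hD₂ a b
  calc ∑ y'' : g.Site, a₁ * Real.exp (-(ρ * D₁ a y'')) * (b₂.κ * (a₂ * Real.exp (-(δ * D₂ y'' b))))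
      = b₂.κ * a₁ * a₂ *
          ∑ y'' : g.Site, Real.exp (-(ρ * D₁ a y'')) * Real.exp (-(δ * D₂ y'' b)) := by
        rw [Finset.mul_sum]; exact Finset.sum_congr rfl fun y'' _ => by ring
    _ ≤ b₂.κ * a₁ * a₂ * (c * Real.exp (-(ρ * infConv D₁ D₂ a b))) :=
        mul_le_mul_of_nonneg_left hconv (mul_nonneg (mul_nonneg b₂.κ_nonneg ha₁) ha₂)
    _ = _ := by ring

/-- A walk-distance majorant is in particular a d-majorant (D ≥ d): the per-term bound implies the bound of the
printed shape with e^{−ρd(y,y′)}. [folklore] -/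
theorem HasMaj.of_domBy {b₁ : BlockNorm g F₁} {b₂ : BlockNorm g F₂} {T : F₁ →ₗ[ℝ] F₂}
    {D : g.Site → g.Site → ℝ} {a ρ : ℝ} (ha : 0 ≤ a) (hρ : 0 ≤ ρ) (hD : DomBy g D)
    (h : HasMaj b₁ b₂ T (fun y y' => a * Real.exp (-(ρ * D y y')))) :
    HasMaj b₁ b₂ T (fun y y' => a * Real.exp (-(ρ * g.dist y y'))) :=
  h.mono fun y y' => mul_le_mul_of_nonneg_left (Real.exp_le_exp.mpr (by nlinarith [hD y y'])) ha

end Conv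

/-! ## 3. Chains: a walk of walk terms (a list of steps applied to a seed) — the per-term majorant in closed form -/

section Chain

variable {F₀ F : Type} [AddCommGroup F₀] [Module ℝ F₀] [AddCommGroup F] [Module ℝ F] {ι : Type}

/-- The operator of the chain l = [i₁, …, iₙ] over the seed S: K_{i₁} ∘ ⋯ ∘ K_{iₙ} ∘ S (for (3.130): the steps are
terms of G₀Δ′_π = 𝒢𝒯, the seed a term of G₀𝒳). [cite: Balaban1985BackgroundPropagators, (3.107) p.416 + (3.130) p.421] -/
def chainOp (K : ι → Module.End ℝ F) (S : F₀ →ₗ[ℝ] F) : List ι → (F₀ →ₗ[ℝ] F)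
  | [] => S
  | i :: l => K i ∘ₗ chainOp K S l

/-- The constant of the chain: A·Π_j (κθ_{i_j}c) — one cutting cost κ, one step constant, one row sum per step.
[cite: Balaban1985BackgroundPropagators, (3.92) p.410] -/
def chainConst (κ c : ℝ) (θ : ι → ℝ) (A : ℝ) : List ι → ℝ
  | [] => A
  | i :: l => κ * θ i * chainConst κ c θ A l * c

/-- The walk distance of the chain: D_{i₁} □ (D_{i₂} □ ( ⋯ □ D_S)) ((3.93) for the concatenated walk).
[cite: Balaban1985BackgroundPropagators, (3.93) p.410] -/
noncomputable def chainDist (D : ι → g.Site → g.Site → ℝ) (DS : g.Site → g.Site → ℝ) :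
    List ι → g.Site → g.Site → ℝ
  | [] => DS
  | i :: l => infConv (D i) (chainDist D DS l)

/-- The empty chain is the seed. [folklore] -/
@[simp] theorem chainOp_nil (K : ι → Module.End ℝ F) (S : F₀ →ₗ[ℝ] F) : chainOp K S [] = S := rfl

/-- One more step on the left. [folklore] -/
@[simp] theorem chainOp_cons (K : ι → Module.End ℝ F) (S : F₀ →ₗ[ℝ] F) (i : ι) (l : List ι) :
    chainOp K S (i :: l) = K i ∘ₗ chainOp K S l := rfl

/-- Constant of the empty chain. [folklore] -/
@[simp] theorem chainConst_nil (κ c : ℝ) (θ : ι → ℝ) (A : ℝ) : chainConst κ c θ A [] = A := rfl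

/-- Constant of a chain with one more step. [folklore] -/
@[simp] theorem chainConst_cons (κ c : ℝ) (θ : ι → ℝ) (A : ℝ) (i : ι) (l : List ι) :
    chainConst κ c θ A (i :: l) = κ * θ i * chainConst κ c θ A l * c := rfl

/-- Distance of the empty chain. [folklore] -/
@[simp] theorem chainDist_nil (D : ι → g.Site → g.Site → ℝ) (DS : g.Site → g.Site → ℝ) :
    chainDist D DS [] = DS := rfl

/-- Distance of a chain with one more step. [folklore] -/
@[simp] theorem chainDist_cons (D : ι → g.Site → g.Site → ℝ) (DS : g.Site → g.Site → ℝ) (i : ι)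
    (l : List ι) : chainDist D DS (i :: l) = infConv (D i) (chainDist D DS l) := rfl

/-- The chain operator is additive in the seed over finite sums. [folklore] -/
theorem chainOp_seed_sum {WS : Type} (K : ι → Module.End ℝ F) (S : WS → F₀ →ₗ[ℝ] F) (s : Finset WS)
    (l : List ι) : chainOp K (∑ ω ∈ s, S ω) l = ∑ ω ∈ s, chainOp K (S ω) l := by
  induction l with
  | nil => simp
  | cons i l ih =>
      rw [chainOp_cons, ih]
      ext v
      simp [LinearMap.sum_apply, map_sum]

/-- The closed form of the constant: A times the product of the step factors κθᵢc.
[cite: Balaban1985BackgroundPropagators, (3.108) p.416] -/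
theorem chainConst_eq_prod (κ c : ℝ) (θ : ι → ℝ) (A : ℝ) (l : List ι) :
    chainConst κ c θ A l = (l.map fun i => κ * θ i * c).prod * A := by
  induction l with
  | nil => simp
  | cons i l ih => rw [chainConst_cons, ih, List.map_cons, List.prod_cons]; ring

/-- The chain constant is non-negative. [folklore] -/
theorem chainConst_nonneg {κ c : ℝ} {θ : ι → ℝ} {A : ℝ} (hκ : 0 ≤ κ) (hc : 0 ≤ c) (hθ : ∀ i, 0 ≤ θ i)
    (hA : 0 ≤ A) (l : List ι) : 0 ≤ chainConst κ c θ A l := by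
  induction l with
  | nil => simpa
  | cons i l ih => rw [chainConst_cons]; exact mul_nonneg (mul_nonneg (mul_nonneg hκ (hθ i)) ih) hc

/-- With a UNIFORM step factor θᵢ ≤ θ̄ the constant is at most A(κθ̄c)^{|l|} — the geometric factor of (3.108) in the
number of steps. [cite: Balaban1985BackgroundPropagators, (3.108) p.416] -/
theorem chainConst_le_pow {κ c θbar : ℝ} {θ : ι → ℝ} {A : ℝ} (hκ : 0 ≤ κ) (hc : 0 ≤ c) (hθ : ∀ i, 0 ≤ θ i)
    (hθle : ∀ i, θ i ≤ θbar) (hA : 0 ≤ A) (l : List ι) :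
    chainConst κ c θ A l ≤ A * (κ * θbar * c) ^ l.length := by
  induction l with
  | nil => simp
  | cons i l ih =>
      rw [chainConst_cons, List.length_cons, pow_succ]
      have h0 := chainConst_nonneg hκ hc hθ hA l
      have hθb : 0 ≤ θbar := (hθ i).trans (hθle i)
      calc κ * θ i * chainConst κ c θ A l * c ≤ κ * θbar * (A * (κ * θbar * c) ^ l.length) * c := by
            gcongr
            exact hθle i
        _ = A * ((κ * θbar * c) ^ l.length * (κ * θbar * c)) := by ring

/-- The chain distance dominates d ((2.54) at every junction). [cite: Balaban1984PropagatorsII, (2.54) p.233] -/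
theorem domBy_chainDist (htri : Triangle254 g) {D : ι → g.Site → g.Site → ℝ} {DS : g.Site → g.Site → ℝ}
    (hD : ∀ i, DomBy g (D i)) (hDS : DomBy g DS) (l : List ι) : DomBy g (chainDist D DS l) := by
  induction l with
  | nil => simpa
  | cons i l ih => exact domBy_infConv htri (hD i) ih

/-- The chain distance passes through every localization the SEED passes through. [cite: Balaban1985BackgroundPropagators, (3.93) p.410] -/
theorem through_chainDist_seed (htri : Triangle254 g) {D : ι → g.Site → g.Site → ℝ}
    {DS : g.Site → g.Site → ℝ} {X : Set g.Site} (hD : ∀ i, DomBy g (D i)) (hX : Through g DS X)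
    (l : List ι) : Through g (chainDist D DS l) X := by
  induction l with
  | nil => simpa
  | cons i l ih => exact through_infConv_right htri (hD i) ih

/-- The chain distance passes through every localization a STEP of the chain passes through — the abstract form,
on the DECAY side, of *"A term in this expansion, corresponding to a walk ω, depends on configuration U restricted
to X̃₀⁵ ∪ X̃₁⁵ ∪ … ∪ X̃ₙ⁵"*: each Xᵢ is visited. [cite: Balaban1985BackgroundPropagators, Thm 3.10 p.416 + (3.93) p.410] -/
theorem through_chainDist_mem (htri : Triangle254 g) {D : ι → g.Site → g.Site → ℝ}
    {DS : g.Site → g.Site → ℝ} {X : Set g.Site} (hD : ∀ i, DomBy g (D i)) (hDS : DomBy g DS) {i : ι}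
    (hX : Through g (D i) X) : ∀ l : List ι, i ∈ l → Through g (chainDist D DS l) X := by
  intro l
  induction l with
  | nil => intro h; simp at h
  | cons j l ih =>
      intro hmem
      rcases List.mem_cons.mp hmem with hij | hl
      · subst hij
        exact through_infConv_left htri hX (domBy_chainDist htri hD hDS l)
      · exact through_infConv_right htri (hD j) (ih hl)

/-- **THE TERM OF A WALK OF WALK TERMS** (per-term bound of the concatenated/iterated expansion, (3.108) shape):
steps Kᵢ with majorants θᵢe^{−δDᵢ} (Dᵢ ≥ d) on the state norm b, seed S with Ae^{−ρD_S}, ρ + σ ≤ δ ⇒ the chain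
K_{i₁}⋯K_{iₙ}S has majorant A·Π(κθ_{i_j}c)·e^{−ρ·D_chain} — the SAME rate ρ on the concatenated walk distance.
KERNEL-CHECKED by n uses of `hasMaj_comp_walk`. [cite: Balaban1985BackgroundPropagators, (3.107)–(3.108) p.416 + p.422 (after (3.131))] -/
theorem chain_majorant {b₀ : BlockNorm g F₀} {b : BlockNorm g F} {K : ι → Module.End ℝ F} {S : F₀ →ₗ[ℝ] F}
    {θ : ι → ℝ} {D : ι → g.Site → g.Site → ℝ} {DS : g.Site → g.Site → ℝ} {A δ ρ σ c : ℝ}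
    (hd : ∀ a b : g.Site, 0 ≤ g.dist a b) (hrow : RowSum g σ c) (hσ : 0 ≤ σ)
    (hθ : ∀ i, 0 ≤ θ i) (hA : 0 ≤ A) (hρ : 0 ≤ ρ) (hρδ : ρ + σ ≤ δ) (hD : ∀ i, DomBy g (D i))
    (hK : ∀ i, HasMaj b b (K i) (fun a b' => θ i * Real.exp (-(δ * D i a b'))))
    (hS : HasMaj b₀ b S (fun a b' => A * Real.exp (-(ρ * DS a b')))) (l : List ι) :
    HasMaj b₀ b (chainOp K S l)
      (fun a b' => chainConst b.κ c θ A l * Real.exp (-(ρ * chainDist D DS l a b'))) := by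
  have hc : 0 ≤ c ∨ IsEmpty g.Site := by
    by_cases hne : Nonempty g.Site
    · exact Or.inl (hrow.nonneg (Classical.arbitrary _))
    · exact Or.inr (not_nonempty_iff.mp hne)
  rcases hc with hc | hemp
  swap
  · intro y' μ hμ y
    exact (IsEmpty.false y).elim
  induction l with
  | nil => simpa
  | cons i l ih =>
      have h := hasMaj_comp_walk (b₁ := b₀) (b₂ := b) (b₃ := b) hd hrow hσ (hθ i)
        (chainConst_nonneg b.κ_nonneg hc hθ hA l) hρ hρδ (hD i) (hK i) ih
      refine (h.congr fun μ => rfl).mono fun a b' => le_of_eq ?_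
      simp only [chainConst_cons, chainDist_cons]

end Chain

/-! ## 4. Summability WITHOUT counting walks: uniform bounds on partial sums of majorant families, preserved under
concatenation -/

section MajSum

/-- The 𝔅-convolution of two majorants through the cutting cost κ (the majorant of a composition, `hasMaj_comp`).
[cite: Balaban1984PropagatorsII, (2.52)–(2.55) p.232] -/
def conv (κ : ℝ) (K₁ K₂ : g.Site → g.Site → ℝ) (a b : g.Site) : ℝ :=
  ∑ y'' : g.Site, K₁ a y'' * (κ * K₂ y'' b)

/-- conv of non-negative majorants is non-negative. [folklore] -/
theorem conv_nonneg {κ : ℝ} {K₁ K₂ : g.Site → g.Site → ℝ} (hκ : 0 ≤ κ) (h₁ : ∀ a b, 0 ≤ K₁ a b)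
    (h₂ : ∀ a b, 0 ≤ K₂ a b) (a b : g.Site) : 0 ≤ conv κ K₁ K₂ a b :=
  Finset.sum_nonneg fun _ _ => mul_nonneg (h₁ _ _) (mul_nonneg hκ (h₂ _ _))

/-- conv is monotone in both arguments (non-negative data). [folklore] -/
theorem conv_mono {κ : ℝ} {K₁ K₂ K₁' K₂' : g.Site → g.Site → ℝ} (hκ : 0 ≤ κ) (h₁ : ∀ a b, 0 ≤ K₁ a b)
    (h₂' : ∀ a b, 0 ≤ K₂' a b) (hle₁ : ∀ a b, K₁ a b ≤ K₁' a b) (hle₂ : ∀ a b, K₂ a b ≤ K₂' a b)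
    (a b : g.Site) : conv κ K₁ K₂ a b ≤ conv κ K₁' K₂' a b :=
  Finset.sum_le_sum fun _ _ =>
    (mul_le_mul_of_nonneg_left (mul_le_mul_of_nonneg_left (hle₂ _ _) hκ) (h₁ _ _)).trans
      (mul_le_mul_of_nonneg_right (hle₁ _ _) (mul_nonneg hκ (h₂' _ _)))

/-- conv is additive in the first argument over finite sums. [folklore] -/
theorem conv_sum_left {κ : ℝ} {W : Type} (s : Finset W) (K₁ : W → g.Site → g.Site → ℝ)
    (K₂ : g.Site → g.Site → ℝ) (a b : g.Site) :
    conv κ (fun a' b' => ∑ ω ∈ s, K₁ ω a' b') K₂ a b = ∑ ω ∈ s, conv κ (K₁ ω) K₂ a b := by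
  simp only [conv, Finset.sum_mul]
  rw [Finset.sum_comm]

/-- conv is additive in the second argument over finite sums. [folklore] -/
theorem conv_sum_right {κ : ℝ} {W : Type} (s : Finset W) (K₁ : g.Site → g.Site → ℝ)
    (K₂ : W → g.Site → g.Site → ℝ) (a b : g.Site) :
    conv κ K₁ (fun a' b' => ∑ ω ∈ s, K₂ ω a' b') a b = ∑ ω ∈ s, conv κ K₁ (K₂ ω) a b := by
  simp only [conv, Finset.mul_sum]
  rw [Finset.sum_comm]

/-- The exponential shape is reproduced by conv ((2.54) + (2.61)): conv κ (A₁e^{−ρ₁d}) (A₂e^{−ρ₂d}) ≤ κA₁A₂c·e^{−ρd}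
for ρ ≤ ρ₂, ρ + σ ≤ ρ₁. [cite: Balaban1984PropagatorsII, (2.54)–(2.56) p.233 + (2.61) p.234] -/
theorem conv_exp_shape_le {κ A₁ A₂ ρ₁ ρ₂ ρ σ c : ℝ} (htri : Triangle254 g) (hd : ∀ a b : g.Site, 0 ≤ g.dist a b)
    (hrow : RowSum g σ c) (hκ : 0 ≤ κ) (hA₁ : 0 ≤ A₁) (hA₂ : 0 ≤ A₂) (hρ : 0 ≤ ρ) (hρ₂ : ρ ≤ ρ₂)
    (hρ₁ : ρ + σ ≤ ρ₁) (a b : g.Site) :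
    conv κ (fun y y' => A₁ * Real.exp (-(ρ₁ * g.dist y y')))
        (fun y y' => A₂ * Real.exp (-(ρ₂ * g.dist y y'))) a b ≤
      κ * A₁ * A₂ * c * Real.exp (-(ρ * g.dist a b)) := by
  have hconv := conv_exp_le htri hd hrow hρ hρ₂ hρ₁ a b
  calc conv κ (fun y y' => A₁ * Real.exp (-(ρ₁ * g.dist y y')))
          (fun y y' => A₂ * Real.exp (-(ρ₂ * g.dist y y'))) a b
      = κ * A₁ * A₂ * ∑ y'' : g.Site, Real.exp (-(ρ₁ * g.dist a y'')) * Real.exp (-(ρ₂ * g.dist y'' b)) := by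
        rw [conv, Finset.mul_sum]; exact Finset.sum_congr rfl fun y'' _ => by ring
    _ ≤ κ * A₁ * A₂ * (c * Real.exp (-(ρ * g.dist a b))) :=
        mul_le_mul_of_nonneg_left hconv (mul_nonneg (mul_nonneg hκ hA₁) hA₂)
    _ = _ := by ring

/-- The walk form: conv κ (θe^{−δD₁}) (Ae^{−ρD₂}) ≤ κθAc·e^{−ρ(D₁□D₂)} (D₁ ≥ d, ρ + σ ≤ δ).
[cite: Balaban1985BackgroundPropagators, (3.92)–(3.94) p.410] -/
theorem conv_walk_shape_le {κ θ A δ ρ σ c : ℝ} {D₁ D₂ : g.Site → g.Site → ℝ}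
    (hd : ∀ a b : g.Site, 0 ≤ g.dist a b) (hrow : RowSum g σ c) (hσ : 0 ≤ σ) (hκ : 0 ≤ κ) (hθ : 0 ≤ θ)
    (hA : 0 ≤ A) (hρ : 0 ≤ ρ) (hρδ : ρ + σ ≤ δ) (hD₁ : DomBy g D₁) (a b : g.Site) :
    conv κ (fun y y' => θ * Real.exp (-(δ * D₁ y y'))) (fun y y' => A * Real.exp (-(ρ * D₂ y y'))) a b ≤
      κ * θ * A * c * Real.exp (-(ρ * infConv D₁ D₂ a b)) := by
  have hconv := conv_walk_le (D₂ := D₂) hd hrow hσ hρ hρδ hD₁ a b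
  calc conv κ (fun y y' => θ * Real.exp (-(δ * D₁ y y'))) (fun y y' => A * Real.exp (-(ρ * D₂ y y'))) a b
      = κ * θ * A * ∑ y'' : g.Site, Real.exp (-(δ * D₁ a y'')) * Real.exp (-(ρ * D₂ y'' b)) := by
        rw [conv, Finset.mul_sum]; exact Finset.sum_congr rfl fun y'' _ => by ring
    _ ≤ κ * θ * A * (c * Real.exp (-(ρ * infConv D₁ D₂ a b))) :=
        mul_le_mul_of_nonneg_left hconv (mul_nonneg (mul_nonneg hκ hθ) hA)
    _ = _ := by ring

variable {F₁ F₂ F₃ : Type} [AddCommGroup F₁] [Module ℝ F₁] [AddCommGroup F₂] [Module ℝ F₂]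
  [AddCommGroup F₃] [Module ℝ F₃]

/-- The majorant of a composition IS the conv of the majorants (`B11SectG.hasMaj_comp`, renamed). [cite: Balaban1984PropagatorsII, (2.52)–(2.55) p.232] -/
theorem hasMaj_comp_conv {b₁ : BlockNorm g F₁} {b₂ : BlockNorm g F₂} {b₃ : BlockNorm g F₃}
    {T₁ : F₂ →ₗ[ℝ] F₃} {T₂ : F₁ →ₗ[ℝ] F₂} {K₁ K₂ : g.Site → g.Site → ℝ}
    (h₁ : HasMaj b₂ b₃ T₁ K₁) (h₂ : HasMaj b₁ b₂ T₂ K₂) (hK₁ : ∀ a b, 0 ≤ K₁ a b) :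
    HasMaj b₁ b₃ (T₁ ∘ₗ T₂) (conv b₂.κ K₁ K₂) :=
  hasMaj_comp h₁ h₂ hK₁

/-- Finite sums of operators with majorants (any index type). [folklore] -/
theorem hasMaj_finsetSum {W : Type} {b₁ : BlockNorm g F₁} {b₂ : BlockNorm g F₂} (T : W → F₁ →ₗ[ℝ] F₂)
    (K : W → g.Site → g.Site → ℝ) (h : ∀ ω, HasMaj b₁ b₂ (T ω) (K ω)) (s : Finset W) :
    HasMaj b₁ b₂ (∑ ω ∈ s, T ω) (fun a b => ∑ ω ∈ s, K ω a b) := by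
  classical
  induction s using Finset.induction_on with
  | empty => simpa using hasMaj_zero b₁ b₂
  | insert ω s hω ih =>
      have := (h ω).add ih
      simpa [Finset.sum_insert hω] using this

/-- UNIFORMLY BOUNDED PARTIAL SUMS of a majorant family: Σ_{ω∈S} K_ω ≤ K̄ for every finite S — summability of the
non-negative family (K_ω) with the bound K̄, stated without infinite sums; this is what *"From (3.108) it follows
that the expansion (3.107) is convergent in all norms in the inequalities (3.42)–(3.47). This implies Theorem 3.3."*
(p. 416) delivers for each printed expansion: the sum of the per-term bounds is bounded by a bound of the shape of
the represented operator's. [cite: Balaban1985BackgroundPropagators, p.416 (after (3.108))] -/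
def MajSumLe {W : Type} (K : W → g.Site → g.Site → ℝ) (Kbar : g.Site → g.Site → ℝ) : Prop :=
  ∀ (S : Finset W) (a b : g.Site), ∑ ω ∈ S, K ω a b ≤ Kbar a b

/-- A larger bound still bounds the partial sums. [folklore] -/
theorem MajSumLe.mono {W : Type} {K : W → g.Site → g.Site → ℝ} {Kbar Kbar' : g.Site → g.Site → ℝ}
    (h : MajSumLe K Kbar) (hle : ∀ a b, Kbar a b ≤ Kbar' a b) : MajSumLe K Kbar' :=
  fun S a b => (h S a b).trans (hle a b)

/-- Each member of the family is below the bound. [folklore] -/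
theorem MajSumLe.single {W : Type} {K : W → g.Site → g.Site → ℝ} {Kbar : g.Site → g.Site → ℝ}
    (h : MajSumLe K Kbar) (ω : W) (a b : g.Site) : K ω a b ≤ Kbar a b := by
  simpa using h {ω} a b

/-- The bound of the partial sums is non-negative (empty sum). [folklore] -/
theorem MajSumLe.nonneg {W : Type} {K : W → g.Site → g.Site → ℝ} {Kbar : g.Site → g.Site → ℝ}
    (h : MajSumLe K Kbar) (a b : g.Site) : 0 ≤ Kbar a b := by
  simpa using h ∅ a b

/-- Every partial sum of the expansion has the majorant K̄. [cite: Balaban1985BackgroundPropagators, p.416 (after (3.108))] -/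
theorem MajSumLe.hasMaj_partialSum {W : Type} {b₁ : BlockNorm g F₁} {b₂ : BlockNorm g F₂}
    {T : W → F₁ →ₗ[ℝ] F₂} {K : W → g.Site → g.Site → ℝ} {Kbar : g.Site → g.Site → ℝ}
    (hT : ∀ ω, HasMaj b₁ b₂ (T ω) (K ω)) (hsum : MajSumLe K Kbar) (S : Finset W) :
    HasMaj b₁ b₂ (∑ ω ∈ S, T ω) Kbar :=
  (hasMaj_finsetSum T K hT S).mono fun a b => hsum S a b

/-- **CONCATENATION PRESERVES SUMMABILITY**: if Σ_{S₁}K¹ ≤ K̄₁ and Σ_{S₂}K² ≤ K̄₂ (all ≥ 0) then for every finite set S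
of PAIRS Σ_{(ω₁,ω₂)∈S} conv κ K¹_{ω₁} K²_{ω₂} ≤ conv κ K̄₁ K̄₂ — the sum over concatenated walks is controlled by
the product structure; no counting of walks is needed. [cite: Balaban1985BackgroundPropagators, p.422 (after (3.131))] -/
theorem MajSumLe.prod {W₁ W₂ : Type} {κ : ℝ} {K₁ : W₁ → g.Site → g.Site → ℝ}
    {K₂ : W₂ → g.Site → g.Site → ℝ} {Kbar₁ Kbar₂ : g.Site → g.Site → ℝ} (hκ : 0 ≤ κ)
    (h₁nn : ∀ ω a b, 0 ≤ K₁ ω a b) (h₂nn : ∀ ω a b, 0 ≤ K₂ ω a b) (h₁ : MajSumLe K₁ Kbar₁)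
    (h₂ : MajSumLe K₂ Kbar₂) :
    MajSumLe (fun p : W₁ × W₂ => conv κ (K₁ p.1) (K₂ p.2)) (conv κ Kbar₁ Kbar₂) := by
  classical
  intro S a b
  calc ∑ p ∈ S, conv κ (K₁ p.1) (K₂ p.2) a b
      ≤ ∑ p ∈ S.image Prod.fst ×ˢ S.image Prod.snd, conv κ (K₁ p.1) (K₂ p.2) a b :=
        Finset.sum_le_sum_of_subset_of_nonneg Finset.subset_product
          fun p _ _ => conv_nonneg hκ (h₁nn p.1) (h₂nn p.2) a b
    _ = ∑ ω₁ ∈ S.image Prod.fst, ∑ ω₂ ∈ S.image Prod.snd, conv κ (K₁ ω₁) (K₂ ω₂) a b :=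
        Finset.sum_product _ _ _
    _ = conv κ (fun a' b' => ∑ ω₁ ∈ S.image Prod.fst, K₁ ω₁ a' b')
          (fun a' b' => ∑ ω₂ ∈ S.image Prod.snd, K₂ ω₂ a' b') a b := by
        rw [conv_sum_left]
        exact Finset.sum_congr rfl fun ω₁ _ => (conv_sum_right _ _ _ a b).symm
    _ ≤ conv κ Kbar₁ Kbar₂ a b :=
        conv_mono hκ (fun a' b' => Finset.sum_nonneg fun ω _ => h₁nn ω a' b') h₂.nonneg
          (fun a' b' => h₁ _ a' b') (fun a' b' => h₂ _ a' b') a b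

end MajSum

/-! ## 5. The Neumann family (all chains over all seeds, (3.130) with every operator expanded): iterated majorants,
summability with the constant A(1 − q)⁻¹, the partial sums as operators, and convergence -/

section Neumann

variable {F₀ F : Type} [AddCommGroup F₀] [Module ℝ F₀] [AddCommGroup F] [Module ℝ F] {ι WS : Type}

/-- The ITERATED majorant of a chain: conv through the steps (before the form is closed). [folklore] -/
def chainMaj (κ : ℝ) (mK : ι → g.Site → g.Site → ℝ) (mS : g.Site → g.Site → ℝ) :
    List ι → g.Site → g.Site → ℝ
  | [] => mS
  | i :: l => conv κ (mK i) (chainMaj κ mK mS l)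

/-- Iterated majorant of the empty chain. [folklore] -/
@[simp] theorem chainMaj_nil (κ : ℝ) (mK : ι → g.Site → g.Site → ℝ) (mS : g.Site → g.Site → ℝ) :
    chainMaj κ mK mS [] = mS := rfl

/-- Iterated majorant of a chain with one more step. [folklore] -/
@[simp] theorem chainMaj_cons (κ : ℝ) (mK : ι → g.Site → g.Site → ℝ) (mS : g.Site → g.Site → ℝ) (i : ι)
    (l : List ι) : chainMaj κ mK mS (i :: l) = conv κ (mK i) (chainMaj κ mK mS l) := rfl

/-- The iterated majorant is non-negative. [folklore] -/
theorem chainMaj_nonneg {κ : ℝ} {mK : ι → g.Site → g.Site → ℝ} {mS : g.Site → g.Site → ℝ} (hκ : 0 ≤ κ)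
    (hK : ∀ i a b, 0 ≤ mK i a b) (hS : ∀ a b, 0 ≤ mS a b) (l : List ι) (a b : g.Site) :
    0 ≤ chainMaj κ mK mS l a b := by
  induction l generalizing a b with
  | nil => exact hS a b
  | cons i l ih => exact conv_nonneg hκ (hK i) ih a b

/-- The chain operator has the iterated majorant. [cite: Balaban1984PropagatorsII, (2.52)–(2.55) p.232] -/
theorem hasMaj_chainOp {b₀ : BlockNorm g F₀} {b : BlockNorm g F} {K : ι → Module.End ℝ F} {S : F₀ →ₗ[ℝ] F}
    {mK : ι → g.Site → g.Site → ℝ} {mS : g.Site → g.Site → ℝ} (hKnn : ∀ i a b', 0 ≤ mK i a b')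
    (hK : ∀ i, HasMaj b b (K i) (mK i)) (hS : HasMaj b₀ b S mS) (l : List ι) :
    HasMaj b₀ b (chainOp K S l) (chainMaj b.κ mK mS l) := by
  induction l with
  | nil => simpa
  | cons i l ih =>
      rw [chainOp_cons, chainMaj_cons]
      exact hasMaj_comp (hK i) ih (hKnn i)

/-- The iterated majorant is monotone in the step and seed majorants (everything ≥ 0). [folklore] -/
theorem chainMaj_mono {κ : ℝ} {mK mK' : ι → g.Site → g.Site → ℝ} {mS mS' : g.Site → g.Site → ℝ} (hκ : 0 ≤ κ)
    (hK : ∀ i a b, 0 ≤ mK i a b) (hK' : ∀ i a b, 0 ≤ mK' i a b) (hS' : ∀ a b, 0 ≤ mS' a b)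
    (hleK : ∀ i a b, mK i a b ≤ mK' i a b) (hleS : ∀ a b, mS a b ≤ mS' a b) (l : List ι) (a b : g.Site) :
    chainMaj κ mK mS l a b ≤ chainMaj κ mK' mS' l a b := by
  induction l generalizing a b with
  | nil => exact hleS a b
  | cons i l ih =>
      exact conv_mono hκ (hK i) (chainMaj_nonneg hκ hK' hS' l) (hleK i) ih a b

/-- The iterated majorant is bounded by the CLOSED FORM of §3: steps θᵢe^{−δDᵢ} (Dᵢ ≥ d), seed Ae^{−ρD_S},
ρ + σ ≤ δ ⇒ chainMaj ≤ A·Π(κθᵢc)·e^{−ρD_chain}. [cite: Balaban1985BackgroundPropagators, (3.92)–(3.94) p.410] -/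
theorem chainMaj_le_closed {κ : ℝ} {mK : ι → g.Site → g.Site → ℝ} {mS : g.Site → g.Site → ℝ}
    {θ : ι → ℝ} {D : ι → g.Site → g.Site → ℝ} {DS : g.Site → g.Site → ℝ} {A δ ρ σ c : ℝ}
    (hd : ∀ a b : g.Site, 0 ≤ g.dist a b) (hrow : RowSum g σ c) (hσ : 0 ≤ σ) (hκ : 0 ≤ κ)
    (hθ : ∀ i, 0 ≤ θ i) (hA : 0 ≤ A) (hρ : 0 ≤ ρ) (hρδ : ρ + σ ≤ δ) (hD : ∀ i, DomBy g (D i))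
    (hKnn : ∀ i a b, 0 ≤ mK i a b)
    (hK : ∀ i a b, mK i a b ≤ θ i * Real.exp (-(δ * D i a b)))
    (hS : ∀ a b, mS a b ≤ A * Real.exp (-(ρ * DS a b))) (l : List ι) (a b : g.Site) :
    chainMaj κ mK mS l a b ≤ chainConst κ c θ A l * Real.exp (-(ρ * chainDist D DS l a b)) := by
  have hc : 0 ≤ c := hrow.nonneg a
  induction l generalizing a b with
  | nil => simpa using hS a b
  | cons i l ih =>
      rw [chainMaj_cons, chainConst_cons, chainDist_cons]
      have hcl : ∀ a b, 0 ≤ chainConst κ c θ A l * Real.exp (-(ρ * chainDist D DS l a b)) :=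
        fun a b => mul_nonneg (chainConst_nonneg hκ hc hθ hA l) (Real.exp_nonneg _)
      calc conv κ (mK i) (chainMaj κ mK mS l) a b
          ≤ conv κ (fun a b => θ i * Real.exp (-(δ * D i a b)))
              (fun a b => chainConst κ c θ A l * Real.exp (-(ρ * chainDist D DS l a b))) a b :=
            conv_mono hκ (hKnn i) hcl (hK i) ih a b
        _ ≤ κ * θ i * chainConst κ c θ A l * c * Real.exp (-(ρ * infConv (D i) (chainDist D DS l) a b)) :=
            conv_walk_shape_le hd hrow hσ hκ (hθ i) (chainConst_nonneg hκ hc hθ hA l) hρ hρδ (hD i) a b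

/-- The iterated majorant is additive in the seed over finite sums. [folklore] -/
theorem chainMaj_seed_sum {κ : ℝ} (mK : ι → g.Site → g.Site → ℝ) (s : Finset WS)
    (mS : WS → g.Site → g.Site → ℝ) (l : List ι) :
    ∀ a b : g.Site, chainMaj κ mK (fun a' b' => ∑ ω ∈ s, mS ω a' b') l a b =
      ∑ ω ∈ s, chainMaj κ mK (mS ω) l a b := by
  induction l with
  | nil => intro a b; simp
  | cons i l ih =>
      intro a b
      rw [chainMaj_cons]
      have hfun : chainMaj κ mK (fun a' b' => ∑ ω ∈ s, mS ω a' b') l =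
          fun a' b' => ∑ ω ∈ s, chainMaj κ mK (mS ω) l a' b' := funext fun a' => funext fun b' => ih a' b'
      rw [hfun, conv_sum_right]
      rfl

variable [DecidableEq ι]

/-- The lists of length n with entries in the finite set I — the chains of n steps over a finite stock of step
terms (the index set of the n-th level of a truncated expansion). [folklore] -/
def lists (I : Finset ι) : ℕ → Finset (List ι)
  | 0 => {[]}
  | n + 1 => (I ×ˢ lists I n).image fun p => p.1 :: p.2

/-- The only chain of length 0 is the empty one. [folklore] -/
@[simp] theorem lists_zero (I : Finset ι) : lists I 0 = {[]} := rfl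

/-- Chains of length n + 1 = (first step, chain of length n). [folklore] -/
theorem lists_succ (I : Finset ι) (n : ℕ) :
    lists I (n + 1) = (I ×ˢ lists I n).image fun p => p.1 :: p.2 := rfl

/-- Members of `lists I n` have length n. [folklore] -/
theorem length_of_mem_lists {I : Finset ι} : ∀ {n : ℕ} {l : List ι}, l ∈ lists I n → l.length = n := by
  intro n
  induction n with
  | zero => intro l hl; rw [lists_zero, Finset.mem_singleton] at hl; simp [hl]
  | succ n ih =>
      intro l hl
      rw [lists_succ, Finset.mem_image] at hl
      obtain ⟨p, hp, rfl⟩ := hl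
      rw [Finset.mem_product] at hp
      simp [ih hp.2]

/-- A chain with entries in I is in `lists I` at its length. [folklore] -/
theorem mem_lists_of_forall_mem {I : Finset ι} :
    ∀ l : List ι, (∀ i ∈ l, i ∈ I) → l ∈ lists I l.length := by
  intro l
  induction l with
  | nil => intro _; simp
  | cons i l ih =>
      intro h
      rw [List.length_cons, lists_succ, Finset.mem_image]
      exact ⟨(i, l), Finset.mem_product.mpr ⟨h i (by simp), ih fun j hj => h j (by simp [hj])⟩, rfl⟩

/-- Prepending is injective on (step, chain) pairs. [folklore] -/
theorem cons_injOn (I : Finset ι) (n : ℕ) :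
    Set.InjOn (fun p : ι × List ι => p.1 :: p.2) ↑(I ×ˢ lists I n) := by
  intro p _ q _ h
  have h' : p.1 :: p.2 = q.1 :: q.2 := h
  simp only [List.cons.injEq] at h'
  exact Prod.ext h'.1 h'.2

/-- Chains of different lengths are different. [folklore] -/
theorem disjoint_lists (I : Finset ι) {n m : ℕ} (h : n ≠ m) : Disjoint (lists I n) (lists I m) := by
  rw [Finset.disjoint_left]
  intro l hn hm
  exact h ((length_of_mem_lists hn).symm.trans (length_of_mem_lists hm))

/-- Summing over the chains of length n + 1 = summing over (first step, rest). [folklore] -/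
theorem sum_lists_succ {M : Type} [AddCommMonoid M] (I : Finset ι) (n : ℕ) (f : List ι → M) :
    ∑ l ∈ lists I (n + 1), f l = ∑ i ∈ I, ∑ l ∈ lists I n, f (i :: l) := by
  rw [lists_succ, Finset.sum_image (cons_injOn I n), Finset.sum_product]

/-- The sum of the iterated majorants over ALL chains of length n over I is the iterated majorant of the SUMMED
step majorant (multilinearity of conv). [folklore] -/
theorem sum_lists_chainMaj {κ : ℝ} (mK : ι → g.Site → g.Site → ℝ) (mS : g.Site → g.Site → ℝ)
    (I : Finset ι) : ∀ (n : ℕ) (a b : g.Site), ∑ l ∈ lists I n, chainMaj κ mK mS l a b =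
      chainMaj κ (fun _ : Unit => fun a' b' => ∑ i ∈ I, mK i a' b') mS (List.replicate n ()) a b := by
  intro n
  induction n with
  | zero => intro a b; simp
  | succ n ih =>
      intro a b
      rw [sum_lists_succ, List.replicate_succ, chainMaj_cons, conv_sum_left]
      refine Finset.sum_congr rfl fun i _ => ?_
      have hfun : (fun a' b' => ∑ l ∈ lists I n, chainMaj κ mK mS l a' b') =
          chainMaj κ (fun _ : Unit => fun a' b' => ∑ i ∈ I, mK i a' b') mS (List.replicate n ()) :=
        funext fun a' => funext fun b' => ih a' b'
      simp only [chainMaj_cons]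
      rw [← hfun, conv_sum_right]

/-- The sum of the chain OPERATORS over all chains of length n over I with the summed seed is the n-th Neumann term
of the truncated operators: Σ_{l} chainOp K S_Σ l = (Σ_{i∈I} Kᵢ)ⁿ ∘ S_Σ — *"replace each operator in (3.130) by its
random walk expansion"* read backwards (distributivity). [cite: Balaban1985BackgroundPropagators, p.422 (after (3.131)) + (3.130) p.421] -/
theorem sum_lists_chainOp (K : ι → Module.End ℝ F) (S : F₀ →ₗ[ℝ] F) (I : Finset ι) :
    ∀ n : ℕ, ∑ l ∈ lists I n, chainOp K S l = ((∑ i ∈ I, K i) ^ n) ∘ₗ S := by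
  intro n
  induction n with
  | zero => ext v; simp
  | succ n ih =>
      rw [sum_lists_succ]
      simp only [chainOp_cons]
      have hinner : ∀ i ∈ I, ∑ l ∈ lists I n, K i ∘ₗ chainOp K S l = K i ∘ₗ (((∑ i ∈ I, K i) ^ n) ∘ₗ S) := by
        intro i _
        rw [← ih]
        ext v
        simp [LinearMap.sum_apply, map_sum]
      rw [Finset.sum_congr rfl hinner, pow_succ']
      ext v
      simp [LinearMap.sum_apply, Module.End.mul_apply]

/-- **SUMMABILITY OF THE NEUMANN FAMILY WITH THE CONSTANT A(1 − q)⁻¹** — the content of *"We do not have problems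
now with operators without small factors, because each operator Δ′_π provides the small factor α₀"* (p. 422): if
the step majorants sum to at most θ̄e^{−δd} (θ̄ ∝ the small factor) and the seed majorants to at most Ae^{−ρ_Sd},
ρ ≤ ρ_S, ρ + σ ≤ δ and q := κθ̄c < 1, then over EVERY finite set of (chain, seed) pairs the iterated majorants sum
to at most A(1 − q)⁻¹e^{−ρd}. KERNEL-CHECKED (multilinearity + the geometric series; no walk counting).
[cite: Balaban1985BackgroundPropagators, p.422 (after (3.131)) + Thm 3.12 p.423; Balaban1984PropagatorsII, Lemma 2.1 p.234] -/
theorem neumann_majSumLe {κ : ℝ} {mK : ι → g.Site → g.Site → ℝ} {mS : WS → g.Site → g.Site → ℝ}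
    {θbar A δ ρS ρ σ c : ℝ} (hd : ∀ a b : g.Site, 0 ≤ g.dist a b) (hrow : RowSum g σ c) (hσ : 0 ≤ σ)
    (htri : Triangle254 g) (hκ : 0 ≤ κ) (hθ : 0 ≤ θbar) (hA : 0 ≤ A) (hρ : 0 ≤ ρ) (hρS : ρ ≤ ρS)
    (hρδ : ρ + σ ≤ δ) (hKnn : ∀ i a b, 0 ≤ mK i a b) (hSnn : ∀ ω a b, 0 ≤ mS ω a b)
    (hK : MajSumLe mK (fun a b => θbar * Real.exp (-(δ * g.dist a b))))
    (hS : MajSumLe mS (fun a b => A * Real.exp (-(ρS * g.dist a b))))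
    (hq : κ * θbar * c < 1) :
    MajSumLe (fun p : List ι × WS => chainMaj κ mK (mS p.2) p.1)
      (fun a b => A * (1 - κ * θbar * c)⁻¹ * Real.exp (-(ρ * g.dist a b))) := by
  classical
  intro S a b
  have hc : 0 ≤ c := hrow.nonneg a
  set q : ℝ := κ * θbar * c with hqdef
  have hq0 : 0 ≤ q := mul_nonneg (mul_nonneg hκ hθ) hc
  set L : Finset (List ι) := S.image Prod.fst with hL
  set S₀ : Finset WS := S.image Prod.snd with hS₀
  set I : Finset ι := L.biUnion List.toFinset with hI
  set N : ℕ := L.sup List.length with hN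
  -- the summed seed majorant and its bound
  set mSbar : g.Site → g.Site → ℝ := fun a' b' => ∑ ω ∈ S₀, mS ω a' b' with hmSbar
  have hmSbar_le : ∀ a' b', mSbar a' b' ≤ A * Real.exp (-(ρS * g.dist a' b')) := fun a' b' => hS S₀ a' b'
  have hmSbar_nn : ∀ a' b', 0 ≤ mSbar a' b' := fun a' b' => Finset.sum_nonneg fun ω _ => hSnn ω a' b'
  have hexpS_nn : ∀ a' b', 0 ≤ A * Real.exp (-(ρS * g.dist a' b')) :=
    fun a' b' => mul_nonneg hA (Real.exp_nonneg _)
  -- the value attached to a chain l: iterated majorant with the bounding seed Ae^{−ρ_S d}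
  set gl : List ι → ℝ := fun l => chainMaj κ mK (fun a' b' => A * Real.exp (-(ρS * g.dist a' b'))) l a b
    with hgl
  have hgl_nn : ∀ l, 0 ≤ gl l := fun l => chainMaj_nonneg hκ hKnn hexpS_nn l a b
  -- Step 1: reduce to the product set L × S₀ and sum out the seeds
  have h1 : ∑ p ∈ S, chainMaj κ mK (mS p.2) p.1 a b ≤ ∑ l ∈ L, gl l := by
    calc ∑ p ∈ S, chainMaj κ mK (mS p.2) p.1 a b
        ≤ ∑ p ∈ L ×ˢ S₀, chainMaj κ mK (mS p.2) p.1 a b :=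
          Finset.sum_le_sum_of_subset_of_nonneg Finset.subset_product
            fun p _ _ => chainMaj_nonneg hκ hKnn (hSnn p.2) p.1 a b
      _ = ∑ l ∈ L, ∑ ω ∈ S₀, chainMaj κ mK (mS ω) l a b := Finset.sum_product _ _ _
      _ = ∑ l ∈ L, chainMaj κ mK mSbar l a b :=
          Finset.sum_congr rfl fun l _ => (chainMaj_seed_sum mK S₀ mS l a b).symm
      _ ≤ ∑ l ∈ L, gl l :=
          Finset.sum_le_sum fun l _ => chainMaj_mono hκ hKnn hKnn hexpS_nn (fun i a b => le_rfl) hmSbar_le l a b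
  -- Step 2: group the chains by length, enlarge each group to all chains of that length over I
  have hmaps : ∀ l ∈ L, l.length ∈ Finset.range (N + 1) := fun l hl =>
    Finset.mem_range.mpr (Nat.lt_succ_of_le (Finset.le_sup (f := List.length) hl))
  have hentries : ∀ l ∈ L, ∀ i ∈ l, i ∈ I := fun l hl i hi =>
    Finset.mem_biUnion.mpr ⟨l, hl, List.mem_toFinset.mpr hi⟩
  have h2 : ∑ l ∈ L, gl l ≤ ∑ n ∈ Finset.range (N + 1), ∑ l ∈ lists I n, gl l := by
    rw [← Finset.sum_fiberwise_of_maps_to hmaps]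
    refine Finset.sum_le_sum fun n _ => Finset.sum_le_sum_of_subset_of_nonneg (fun l hl => ?_)
      fun l _ _ => hgl_nn l
    rw [Finset.mem_filter] at hl
    rw [← hl.2]
    exact mem_lists_of_forall_mem l (hentries l hl.1)
  -- Step 3: the sum over all chains of length n is the n-fold conv of the summed step majorant, ≤ A qⁿ e^{−ρd}
  have h3 : ∀ n, ∑ l ∈ lists I n, gl l ≤ A * q ^ n * Real.exp (-(ρ * g.dist a b)) := by
    intro n
    rw [hgl]
    simp only []
    rw [sum_lists_chainMaj]
    have hstep_nn : ∀ (_ : Unit) a' b', 0 ≤ ∑ i ∈ I, mK i a' b' :=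
      fun _ a' b' => Finset.sum_nonneg fun i _ => hKnn i a' b'
    have hstep_le : ∀ (_ : Unit) a' b', ∑ i ∈ I, mK i a' b' ≤ θbar * Real.exp (-(δ * g.dist a' b')) :=
      fun _ a' b' => hK I a' b'
    have hseed_le : ∀ a' b', A * Real.exp (-(ρS * g.dist a' b')) ≤ A * Real.exp (-(ρ * g.dist a' b')) :=
      fun a' b' => mul_le_mul_of_nonneg_left (Real.exp_le_exp.mpr (by nlinarith [hd a' b'])) hA
    have hclosed := chainMaj_le_closed (κ := κ) (θ := fun _ : Unit => θbar) (D := fun _ : Unit => g.dist)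
      (DS := g.dist) (A := A) hd hrow hσ hκ (fun _ => hθ) hA hρ hρδ (fun _ => domBy_dist) hstep_nn hstep_le
      hseed_le (List.replicate n ()) a b
    refine hclosed.trans ?_
    have hlen : (List.replicate n ()).length = n := List.length_replicate
    have hconst := chainConst_le_pow (θ := fun _ : Unit => θbar) (A := A) hκ hc (fun _ => hθ)
      (fun _ => le_rfl) hA (List.replicate n ())
    rw [hlen] at hconst
    have hdist : Real.exp (-(ρ * chainDist (fun _ : Unit => g.dist) g.dist (List.replicate n ()) a b)) ≤
        Real.exp (-(ρ * g.dist a b)) :=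
      Real.exp_le_exp.mpr (by
        nlinarith [domBy_chainDist htri (D := fun _ : Unit => g.dist) (DS := g.dist)
          (fun _ => domBy_dist) domBy_dist (List.replicate n ()) a b])
    calc chainConst κ c (fun _ : Unit => θbar) A (List.replicate n ()) *
          Real.exp (-(ρ * chainDist (fun _ : Unit => g.dist) g.dist (List.replicate n ()) a b))
        ≤ A * (κ * θbar * c) ^ n * Real.exp (-(ρ * g.dist a b)) :=
          mul_le_mul hconst hdist (Real.exp_nonneg _) (mul_nonneg hA (pow_nonneg hq0 n))
      _ = A * q ^ n * Real.exp (-(ρ * g.dist a b)) := by rw [hqdef]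
  -- Step 4: the geometric series
  have hgeom : ∑ n ∈ Finset.range (N + 1), q ^ n ≤ (1 - q)⁻¹ :=
    sum_le_hasSum (Finset.range (N + 1)) (fun n _ => pow_nonneg hq0 n) (hasSum_geometric_of_lt_one hq0 hq)
  calc ∑ p ∈ S, chainMaj κ mK (mS p.2) p.1 a b ≤ ∑ l ∈ L, gl l := h1
    _ ≤ ∑ n ∈ Finset.range (N + 1), ∑ l ∈ lists I n, gl l := h2
    _ ≤ ∑ n ∈ Finset.range (N + 1), A * q ^ n * Real.exp (-(ρ * g.dist a b)) :=
        Finset.sum_le_sum fun n _ => h3 n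
    _ = (∑ n ∈ Finset.range (N + 1), q ^ n) * (A * Real.exp (-(ρ * g.dist a b))) := by
        rw [Finset.sum_mul]; exact Finset.sum_congr rfl fun n _ => by ring
    _ ≤ (1 - q)⁻¹ * (A * Real.exp (-(ρ * g.dist a b))) :=
        mul_le_mul_of_nonneg_right hgeom (mul_nonneg hA (Real.exp_nonneg _))
    _ = A * (1 - q)⁻¹ * Real.exp (-(ρ * g.dist a b)) := by ring

/-- The TRUNCATED EXPANSION (partial sum of the Neumann family over the canonical exhaustion: Neumann order < N,
step terms in I, seed terms in S₀) as an operator. [cite: Balaban1985BackgroundPropagators, (3.107) p.416 + (3.130) p.421] -/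
noncomputable def truncExp (K : ι → Module.End ℝ F) (S : WS → F₀ →ₗ[ℝ] F) (N : ℕ) (I : Finset ι)
    (S₀ : Finset WS) : F₀ →ₗ[ℝ] F :=
  ∑ p ∈ ((Finset.range N).biUnion (lists I)) ×ˢ S₀, chainOp K (S p.2) p.1

/-- The truncated expansion IS the Neumann partial sum of the truncated operators: Σ_{n<N} (Σ_{i∈I}Kᵢ)ⁿ ∘ (Σ_{ω∈S₀}S_ω).
[cite: Balaban1985BackgroundPropagators, (3.130) p.421 + p.422 (after (3.131))] -/
theorem truncExp_eq (K : ι → Module.End ℝ F) (S : WS → F₀ →ₗ[ℝ] F) (N : ℕ) (I : Finset ι)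
    (S₀ : Finset WS) :
    truncExp K S N I S₀ = ∑ n ∈ Finset.range N, ((∑ i ∈ I, K i) ^ n) ∘ₗ (∑ ω ∈ S₀, S ω) := by
  classical
  rw [truncExp, Finset.sum_product,
    Finset.sum_biUnion (fun n _ m _ hnm => disjoint_lists I hnm)]
  refine Finset.sum_congr rfl fun n _ => ?_
  rw [← sum_lists_chainOp]
  refine Finset.sum_congr rfl fun l _ => ?_
  rw [chainOp_seed_sum]

/-- **EVERY TRUNCATED EXPANSION HAS THE MAJORANT A(1 − q)⁻¹e^{−ρd}** — the uniform bound behind *"a convergence of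
the series (3.130) … in all norms"* once every operator in it is expanded (per-term majorants `hasMaj_chainOp` +
`neumann_majSumLe`). [cite: Balaban1985BackgroundPropagators, p.422 (after (3.131)) + Thm 3.12 p.423] -/
theorem truncExp_majorant {b₀ : BlockNorm g F₀} {b : BlockNorm g F} {K : ι → Module.End ℝ F}
    {S : WS → F₀ →ₗ[ℝ] F} {mK : ι → g.Site → g.Site → ℝ} {mS : WS → g.Site → g.Site → ℝ}
    {θbar A δ ρS ρ σ c : ℝ} (hd : ∀ a b : g.Site, 0 ≤ g.dist a b) (hrow : RowSum g σ c) (hσ : 0 ≤ σ)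
    (htri : Triangle254 g) (hθ : 0 ≤ θbar) (hA : 0 ≤ A) (hρ : 0 ≤ ρ) (hρS : ρ ≤ ρS) (hρδ : ρ + σ ≤ δ)
    (hKnn : ∀ i a b', 0 ≤ mK i a b') (hSnn : ∀ ω a b', 0 ≤ mS ω a b')
    (hKmaj : ∀ i, HasMaj b b (K i) (mK i)) (hSmaj : ∀ ω, HasMaj b₀ b (S ω) (mS ω))
    (hK : MajSumLe mK (fun a b' => θbar * Real.exp (-(δ * g.dist a b'))))
    (hS : MajSumLe mS (fun a b' => A * Real.exp (-(ρS * g.dist a b'))))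
    (hq : b.κ * θbar * c < 1) (N : ℕ) (I : Finset ι) (S₀ : Finset WS) :
    HasMaj b₀ b (truncExp K S N I S₀)
      (fun a b' => A * (1 - b.κ * θbar * c)⁻¹ * Real.exp (-(ρ * g.dist a b'))) := by
  have hterm : ∀ p : List ι × WS, HasMaj b₀ b (chainOp K (S p.2) p.1) (chainMaj b.κ mK (mS p.2) p.1) :=
    fun p => hasMaj_chainOp hKnn hKmaj (hSmaj p.2) p.1
  exact MajSumLe.hasMaj_partialSum hterm
    (neumann_majSumLe hd hrow hσ htri b.κ_nonneg hθ hA hρ hρS hρδ hKnn hSnn hK hS hq) _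

end Neumann

/-! ## 6. Convergence in the block seminorms: limits inherit uniform majorants; products and Neumann partial sums
of convergent truncations converge; the Neumann remainder -/

section Convergence

variable {F₁ F₂ F₃ : Type} [AddCommGroup F₁] [Module ℝ F₁] [AddCommGroup F₂] [Module ℝ F₂]
  [AddCommGroup F₃] [Module ℝ F₃]

/-- *"convergent in all norms appearing in (3.42)–(3.47)"* for a sequence of truncations A_m of T: the size near
every y of (T − A_m)μ tends to 0, for every μ. [cite: Balaban1985BackgroundPropagators, p.416 (after (3.108)) + p.422 (after (3.131))] -/
def CvgTo (b₂ : BlockNorm g F₂) (A : ℕ → F₁ →ₗ[ℝ] F₂) (T : F₁ →ₗ[ℝ] F₂) : Prop :=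
  ∀ (μ : F₁) (y : g.Site), Filter.Tendsto (fun m => b₂.loc y ((T - A m) μ)) Filter.atTop (nhds 0)

/-- **LIMITS INHERIT UNIFORM MAJORANTS**: if every truncation A_m has the majorant K̄ and A_m → T in the block
seminorms, then T has the majorant K̄ — *"This implies Theorem 3.3"* (p. 416). [cite: Balaban1985BackgroundPropagators, p.416 (after (3.108))] -/
theorem CvgTo.hasMaj_of_uniform {b₁ : BlockNorm g F₁} {b₂ : BlockNorm g F₂} {A : ℕ → F₁ →ₗ[ℝ] F₂}
    {T : F₁ →ₗ[ℝ] F₂} {Kbar : g.Site → g.Site → ℝ} (hcvg : CvgTo b₂ A T) (hA : ∀ m, HasMaj b₁ b₂ (A m) Kbar) :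
    HasMaj b₁ b₂ T Kbar := by
  intro y' μ hμ y
  have hN : ∀ m, b₂.loc y (T μ) ≤ Kbar y y' * b₁.loc y' μ + b₂.loc y ((T - A m) μ) := by
    intro m
    have hsplit : T μ = A m μ + (T - A m) μ := by simp
    calc b₂.loc y (T μ) = b₂.loc y (A m μ + (T - A m) μ) := by rw [← hsplit]
      _ ≤ b₂.loc y (A m μ) + b₂.loc y ((T - A m) μ) := b₂.loc_add_le y _ _
      _ ≤ Kbar y y' * b₁.loc y' μ + b₂.loc y ((T - A m) μ) := add_le_add (hA m y' μ hμ y) le_rfl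
  have hlim : Filter.Tendsto (fun m => Kbar y y' * b₁.loc y' μ + b₂.loc y ((T - A m) μ)) Filter.atTop
      (nhds (Kbar y y' * b₁.loc y' μ + 0)) := (hcvg μ y).const_add _
  rw [add_zero] at hlim
  exact ge_of_tendsto' hlim hN

/-- Sums of convergent truncations converge. [folklore] -/
theorem CvgTo.add {b₂ : BlockNorm g F₂} {A B : ℕ → F₁ →ₗ[ℝ] F₂} {T U : F₁ →ₗ[ℝ] F₂} (hA : CvgTo b₂ A T)
    (hB : CvgTo b₂ B U) : CvgTo b₂ (fun m => A m + B m) (T + U) := by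
  intro μ y
  have hle : ∀ m, b₂.loc y ((T + U - (A m + B m)) μ) ≤ b₂.loc y ((T - A m) μ) + b₂.loc y ((U - B m) μ) := by
    intro m
    have : (T + U - (A m + B m)) μ = (T - A m) μ + (U - B m) μ := by
      simp only [LinearMap.sub_apply, LinearMap.add_apply]; abel
    rw [this]
    exact b₂.loc_add_le y _ _
  have hlim := (hA μ y).add (hB μ y)
  rw [add_zero] at hlim
  exact squeeze_zero (fun m => b₂.loc_nonneg y _) hle hlim

/-- Finite sums (fixed range) of convergent truncations converge. [folklore] -/
theorem CvgTo.sum {b₂ : BlockNorm g F₂} {A : ℕ → ℕ → F₁ →ₗ[ℝ] F₂} {T : ℕ → F₁ →ₗ[ℝ] F₂}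
    (h : ∀ n, CvgTo b₂ (A n) (T n)) (N : ℕ) :
    CvgTo b₂ (fun m => ∑ n ∈ Finset.range N, A n m) (∑ n ∈ Finset.range N, T n) := by
  induction N with
  | zero =>
      intro μ y
      simp [b₂.loc_zero]
  | succ N ih =>
      have := ih.add (h N)
      simpa [Finset.sum_range_succ] using this

/-- **PRODUCTS OF CONVERGENT TRUNCATIONS CONVERGE** (concatenation of two convergent expansions converges to the
composition): A_m → T with a UNIFORM majorant K̄ ≥ 0 of the A_m, and B_m → U ⇒ A_mB_m → TU.
[cite: Balaban1985BackgroundPropagators, p.422 (after (3.131))] -/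
theorem CvgTo.comp {b₂ : BlockNorm g F₂} {b₃ : BlockNorm g F₃}
    {A : ℕ → F₂ →ₗ[ℝ] F₃} {B : ℕ → F₁ →ₗ[ℝ] F₂} {T : F₂ →ₗ[ℝ] F₃} {U : F₁ →ₗ[ℝ] F₂}
    {Kbar : g.Site → g.Site → ℝ} (hA : CvgTo b₃ A T) (hAmaj : ∀ m, HasMaj b₂ b₃ (A m) Kbar)
    (hKbar : ∀ a b, 0 ≤ Kbar a b) (hB : CvgTo b₂ B U) :
    CvgTo b₃ (fun m => A m ∘ₗ B m) (T ∘ₗ U) := by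
  intro μ y
  have hle : ∀ m, b₃.loc y ((T ∘ₗ U - A m ∘ₗ B m) μ) ≤
      b₃.loc y ((T - A m) (U μ)) + ∑ y' : g.Site, Kbar y y' * (b₂.κ * b₂.loc y' ((U - B m) μ)) := by
    intro m
    have hsplit : (T ∘ₗ U - A m ∘ₗ B m) μ = (T - A m) (U μ) + A m ((U - B m) μ) := by
      simp only [LinearMap.sub_apply, LinearMap.comp_apply, map_sub]; abel
    rw [hsplit]
    exact (b₃.loc_add_le y _ _).trans (add_le_add le_rfl ((hAmaj m).bound hKbar _ y))
  have hlim₂ : Filter.Tendsto (fun m => ∑ y' : g.Site, Kbar y y' * (b₂.κ * b₂.loc y' ((U - B m) μ)))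
      Filter.atTop (nhds (∑ y' : g.Site, Kbar y y' * (b₂.κ * 0))) :=
    tendsto_finsetSum _ fun y' _ => ((hB μ y').const_mul b₂.κ).const_mul (Kbar y y')
  simp only [mul_zero, Finset.sum_const_zero] at hlim₂
  have hlim := (hA (U μ) y).add hlim₂
  rw [add_zero] at hlim
  exact squeeze_zero (fun m => b₃.loc_nonneg y _) hle hlim

/-- Powers of convergent truncations converge (uniform majorant on the truncations). [folklore] -/
theorem CvgTo.pow {b : BlockNorm g F₂} {A : ℕ → Module.End ℝ F₂} {T : Module.End ℝ F₂}
    {Kbar : g.Site → g.Site → ℝ} (hA : CvgTo b A T) (hAmaj : ∀ m, HasMaj b b (A m) Kbar)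
    (hKbar : ∀ a b', 0 ≤ Kbar a b') : ∀ n : ℕ, CvgTo b (fun m => A m ^ n) (T ^ n) := by
  intro n
  induction n with
  | zero =>
      intro μ y
      simp [b.loc_zero]
  | succ n ih =>
      have h := CvgTo.comp (b₂ := b) (b₃ := b) hA hAmaj hKbar ih
      intro μ y
      have := h μ y
      simpa [pow_succ', Module.End.mul_eq_comp] using this

/-- Pointwise-equal truncations / limits. [folklore] -/
theorem CvgTo.congr {b₂ : BlockNorm g F₂} {A A' : ℕ → F₁ →ₗ[ℝ] F₂} {T T' : F₁ →ₗ[ℝ] F₂} (h : CvgTo b₂ A T)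
    (hA : ∀ m μ, A m μ = A' m μ) (hT : ∀ μ, T μ = T' μ) : CvgTo b₂ A' T' := by
  intro μ y
  have := h μ y
  simpa only [LinearMap.sub_apply, hA, hT] using this

/-- **THE EXPANDED NEUMANN PARTIAL SUMS CONVERGE**: if the truncated step operators K_m → 𝒦 (with a uniform
majorant) and the truncated seeds S_m → S, then Σ_{n<N} K_mⁿS_m → Σ_{n<N} 𝒦ⁿS for every N — by `truncExp_eq` the
left side is the truncated expansion of Neumann order N. [cite: Balaban1985BackgroundPropagators, p.422 (after (3.131))] -/
theorem CvgTo.neumannPartial {b : BlockNorm g F₂} {Km : ℕ → Module.End ℝ F₂}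
    {𝒦 : Module.End ℝ F₂} {Sm : ℕ → F₁ →ₗ[ℝ] F₂} {S : F₁ →ₗ[ℝ] F₂} {Kbar : g.Site → g.Site → ℝ}
    (hK : CvgTo b Km 𝒦) (hKmaj : ∀ m, HasMaj b b (Km m) Kbar) (hKbar : ∀ a b', 0 ≤ Kbar a b')
    (hS : CvgTo b Sm S) (N : ℕ) :
    CvgTo b (fun m => ∑ n ∈ Finset.range N, (Km m ^ n) ∘ₗ Sm m) (∑ n ∈ Finset.range N, (𝒦 ^ n) ∘ₗ S) := by
  have hn : ∀ n, CvgTo b (fun m => (Km m ^ n) ∘ₗ Sm m) ((𝒦 ^ n) ∘ₗ S) := by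
    intro n
    induction n with
    | zero => exact hS.congr (fun m μ => by simp) (fun μ => by simp)
    | succ n ih =>
        exact (CvgTo.comp (b₂ := b) (b₃ := b) (B := fun m => (Km m ^ n) ∘ₗ Sm m) (U := (𝒦 ^ n) ∘ₗ S)
          hK hKmaj hKbar ih).congr
          (fun m μ => by simp only [LinearMap.comp_apply, pow_succ', Module.End.mul_apply])
          (fun μ => by simp only [LinearMap.comp_apply, pow_succ', Module.End.mul_apply])
  exact CvgTo.sum hn N

/-- **THE NEUMANN REMAINDER**: if G = S + 𝒦G (the fixed-point form of (3.130)), 𝒦 has majorant θe^{−δd} with δ ≥ σ and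
G is a priori bounded (majorant the constant M₀ — norm convergence of (3.130)), then G − Σ_{n<N}𝒦ⁿS = 𝒦ᴺG has the
constant majorant qᴺM₀, q = κθc (→ 0 when q < 1): the truncation in the Neumann order converges.
[cite: Balaban1985BackgroundPropagators, (3.130) p.421 + p.422 (after (3.131)); Balaban1984PropagatorsII, Lemma 2.1 p.234] -/
theorem neumann_remainder {b₀ : BlockNorm g F₁} {b : BlockNorm g F₂} {𝒦 : Module.End ℝ F₂} {S G : F₁ →ₗ[ℝ] F₂}
    {θ δ σ c M₀ : ℝ} (hd : ∀ a b' : g.Site, 0 ≤ g.dist a b') (hrow : RowSum g σ c) (hθ : 0 ≤ θ) (hσδ : σ ≤ δ)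
    (hM₀ : 0 ≤ M₀) (hK : HasMaj b b 𝒦 (fun a b' => θ * Real.exp (-(δ * g.dist a b'))))
    (hfix : G = S + 𝒦 ∘ₗ G) (hap : HasMaj b₀ b G (fun _ _ => M₀)) (N : ℕ) :
    HasMaj b₀ b (G - ∑ n ∈ Finset.range N, (𝒦 ^ n) ∘ₗ S) (fun _ _ => (b.κ * θ * c) ^ N * M₀) := by
  have hc : 0 ≤ c ∨ IsEmpty g.Site := by
    by_cases hne : Nonempty g.Site
    · exact Or.inl (hrow.nonneg (Classical.arbitrary _))
    · exact Or.inr (not_nonempty_iff.mp hne)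
  rcases hc with hc | hemp
  swap
  · intro y' μ hμ y
    exact (IsEmpty.false y).elim
  set q : ℝ := b.κ * θ * c with hqdef
  have hq0 : 0 ≤ q := mul_nonneg (mul_nonneg b.κ_nonneg hθ) hc
  have hrem : ∀ N : ℕ, HasMaj b₀ b ((𝒦 ^ N) ∘ₗ G) (fun _ _ => q ^ N * M₀) := by
    intro N
    induction N with
    | zero =>
        refine hap.congr ?_ |>.mono ?_
        · intro ν; simp
        · intro a b'; simp
    | succ N ih =>
        have hstep := hasMaj_comp_const (b₁ := b₀) (b₂ := b) (b₃ := b) (T₁ := 𝒦) (T₂ := (𝒦 ^ N) ∘ₗ G)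
          hd hrow hθ (mul_nonneg (pow_nonneg hq0 N) hM₀) hσδ hK ih
        refine (hstep.congr fun ν => ?_).mono fun a b' => ?_
        · simp [pow_succ', Module.End.mul_apply]
        · have : b.κ * θ * (q ^ N * M₀) * c = q ^ (N + 1) * M₀ := by rw [hqdef]; ring
          rw [this]
  refine (hrem N).congr fun μ => ?_
  have htel := neumann_telescope hfix N μ
  simp only [LinearMap.sub_apply, LinearMap.comp_apply, LinearMap.coe_sum, Finset.sum_apply]
  rw [eq_sub_iff_add_eq, add_comm]
  exact htel.symm

/-- The remainder bound tends to 0 (q < 1). [folklore] -/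
theorem remainder_tendsto_zero {q M₀ : ℝ} (hq0 : 0 ≤ q) (hq : q < 1) :
    Filter.Tendsto (fun N : ℕ => q ^ N * M₀) Filter.atTop (nhds 0) := by
  have h := (tendsto_pow_atTop_nhds_zero_of_lt_one hq0 hq).mul_const M₀
  rwa [zero_mul] at h

end Convergence

/-- If T has the majorant K̄ + qᴺM₀ for EVERY N (0 ≤ q < 1) then T has the majorant K̄ — the Neumann order sent to
∞. [folklore] -/
theorem hasMaj_of_forall_add_pow {F₁ F₂ : Type} [AddCommGroup F₁] [Module ℝ F₁] [AddCommGroup F₂] [Module ℝ F₂]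
    {b₁ : BlockNorm g F₁} {b₂ : BlockNorm g F₂} {T : F₁ →ₗ[ℝ] F₂} {Kbar : g.Site → g.Site → ℝ} {q M₀ : ℝ}
    (hq0 : 0 ≤ q) (hq : q < 1) (h : ∀ N : ℕ, HasMaj b₁ b₂ T (fun a b' => Kbar a b' + q ^ N * M₀)) :
    HasMaj b₁ b₂ T Kbar := by
  intro y' μ hμ y
  have hN : ∀ N : ℕ, b₂.loc y (T μ) ≤ Kbar y y' * b₁.loc y' μ + q ^ N * M₀ * b₁.loc y' μ := by
    intro N
    have := h N y' μ hμ y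
    simpa [add_mul] using this
  have hlim : Filter.Tendsto (fun N : ℕ => Kbar y y' * b₁.loc y' μ + q ^ N * M₀ * b₁.loc y' μ) Filter.atTop
      (nhds (Kbar y y' * b₁.loc y' μ + 0 * b₁.loc y' μ)) :=
    ((remainder_tendsto_zero hq0 hq).mul_const _).const_add _
  rw [zero_mul, add_zero] at hlim
  exact ge_of_tendsto' hlim hN

/-! ## 7. Section D: the steps of (3.130) are products 𝒢_γ𝒯_τ of walk terms of the two factors of G₀Δ′_π (the
FACTORED form of `B9SectDSup`), the seeds walk terms of G₀𝒳 — per-term bound of the (3.108) shape, uniform majorant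
of every truncated expansion, convergence -/

section SectD

variable {F₀ F P : Type} [AddCommGroup F₀] [Module ℝ F₀] [AddCommGroup F] [Module ℝ F]
  [AddCommGroup P] [Module ℝ P] {Wγ Wτ WS : Type}

/-- The STEP TERM indexed by a pair (γ, τ) = (a walk term of the left factor 𝒢 "G₀ × G₀D", a walk term of the right
factor 𝒯 "Δ′_π split before its leading derivative"): 𝒢_γ ∘ 𝒯_τ. [cite: Balaban1985BackgroundPropagators, (3.130) p.421 + p.422 (after (3.131))] -/
def stepOp (𝒢 : Wγ → P →ₗ[ℝ] F) (𝒯 : Wτ → F →ₗ[ℝ] P) (p : Wγ × Wτ) : Module.End ℝ F :=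
  𝒢 p.1 ∘ₗ 𝒯 p.2

/-- The step term applied. [folklore] -/
@[simp] theorem stepOp_apply (𝒢 : Wγ → P →ₗ[ℝ] F) (𝒯 : Wτ → F →ₗ[ℝ] P) (p : Wγ × Wτ) (v : F) :
    stepOp 𝒢 𝒯 p v = 𝒢 p.1 (𝒯 p.2 v) := rfl

/-- The step term has the conv of the factor majorants. [cite: Balaban1984PropagatorsII, (2.52)–(2.55) p.232] -/
theorem stepOp_hasMaj {bF : BlockNorm g F} {bP : BlockNorm g P} {𝒢 : Wγ → P →ₗ[ℝ] F} {𝒯 : Wτ → F →ₗ[ℝ] P}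
    {m𝒢 : Wγ → g.Site → g.Site → ℝ} {m𝒯 : Wτ → g.Site → g.Site → ℝ} (h𝒢nn : ∀ γ a b, 0 ≤ m𝒢 γ a b)
    (h𝒢 : ∀ γ, HasMaj bP bF (𝒢 γ) (m𝒢 γ)) (h𝒯 : ∀ τ, HasMaj bF bP (𝒯 τ) (m𝒯 τ)) (p : Wγ × Wτ) :
    HasMaj bF bF (stepOp 𝒢 𝒯 p) (conv bP.κ (m𝒢 p.1) (m𝒯 p.2)) :=
  hasMaj_comp (h𝒢 p.1) (h𝒯 p.2) (h𝒢nn p.1)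

/-- Summing the step terms over a product of truncations = the product of the truncated factors (bilinearity).
[folklore] -/
theorem sum_stepOp_product (𝒢 : Wγ → P →ₗ[ℝ] F) (𝒯 : Wτ → F →ₗ[ℝ] P) (Iγ : Finset Wγ) (Iτ : Finset Wτ) :
    ∑ p ∈ Iγ ×ˢ Iτ, stepOp 𝒢 𝒯 p = (∑ γ ∈ Iγ, 𝒢 γ) ∘ₗ (∑ τ ∈ Iτ, 𝒯 τ) := by
  rw [Finset.sum_product]
  ext v
  simp [LinearMap.sum_apply, map_sum]

/-- **THEOREM W (i), KERNEL-CHECKED — THE TERM OF THE SECT.-D EXPANSION HAS THE (3.108) SHAPE.**  Let the factor walk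
terms have majorants 𝒢_γ ↦ B_γe^{−δ_G D_γ}, 𝒯_τ ↦ C_τe^{−δ_T D_τ}, the seed terms 𝒮_ω ↦ A_ωe^{−ρ_S D_ω}, all walk
distances dominating d, and let the rates satisfy ρ + σ ≤ δ ≤ δ_T, δ + σ ≤ δ_G, ρ ≤ ρ_S (σ = the row-sum rate spent
at each junction).  Then the term of (3.130) indexed by the chain ((γ₁,τ₁), …, (γₙ,τₙ)) over the seed ω,
𝒢_{γ₁}𝒯_{τ₁}⋯𝒢_{γₙ}𝒯_{τₙ}𝒮_ω, has the majorant  A_ω · Π_j (κ_F · κ_P B_{γ_j} C_{τ_j} c · c) · e^{−ρ·D_chain(y,y′)},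
D_chain = (D_{γ₁} □ D_{τ₁}) □ ⋯ □ (D_{γₙ} □ D_{τₙ}) □ D_ω ≥ d — a product of per-step factors (each ∝ the small
factor carried by C_τ) times ONE exponential in the concatenated walk distance at the undiminished rate ρ.
[cite: Balaban1985BackgroundPropagators, Thm 3.10 (3.107)–(3.108) p.416 + p.422 (after (3.131)) + Thm 3.12 p.423] -/
theorem sectD_term_majorant {b₀ : BlockNorm g F₀} {bF : BlockNorm g F} {bP : BlockNorm g P}
    {𝒢 : Wγ → P →ₗ[ℝ] F} {𝒯 : Wτ → F →ₗ[ℝ] P} {𝒮 : WS → F₀ →ₗ[ℝ] F}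
    {B : Wγ → ℝ} {C : Wτ → ℝ} {A : WS → ℝ} {Dγ : Wγ → g.Site → g.Site → ℝ}
    {Dτ : Wτ → g.Site → g.Site → ℝ} {DS : WS → g.Site → g.Site → ℝ} {δG δT δ ρS ρ σ c : ℝ}
    (hd : ∀ a b : g.Site, 0 ≤ g.dist a b) (hrow : RowSum g σ c) (hσ : 0 ≤ σ) (htri : Triangle254 g)
    (hB : ∀ γ, 0 ≤ B γ) (hC : ∀ τ, 0 ≤ C τ) (hA : ∀ ω, 0 ≤ A ω)
    (hδ : 0 ≤ δ) (hδT : δ ≤ δT) (hδG : δ + σ ≤ δG) (hρ : 0 ≤ ρ) (hρS : ρ ≤ ρS) (hρδ : ρ + σ ≤ δ)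
    (hDγ : ∀ γ, DomBy g (Dγ γ)) (hDτ : ∀ τ, DomBy g (Dτ τ)) (hDS : ∀ ω, DomBy g (DS ω))
    (h𝒢 : ∀ γ, HasMaj bP bF (𝒢 γ) (fun a b => B γ * Real.exp (-(δG * Dγ γ a b))))
    (h𝒯 : ∀ τ, HasMaj bF bP (𝒯 τ) (fun a b => C τ * Real.exp (-(δT * Dτ τ a b))))
    (h𝒮 : ∀ ω, HasMaj b₀ bF (𝒮 ω) (fun a b => A ω * Real.exp (-(ρS * DS ω a b))))
    (l : List (Wγ × Wτ)) (ω : WS) :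
    HasMaj b₀ bF (chainOp (stepOp 𝒢 𝒯) (𝒮 ω) l)
      (fun a b => chainConst bF.κ c (fun p => bP.κ * B p.1 * C p.2 * c) (A ω) l *
        Real.exp (-(ρ * chainDist (fun p => infConv (Dγ p.1) (Dτ p.2)) (DS ω) l a b))) := by
  -- the step (γ, τ): 𝒢_γ at rate δ_G ≥ δ + σ after 𝒯_τ weakened to rate δ ≤ δ_T
  have h𝒯' : ∀ τ, HasMaj bF bP (𝒯 τ) (fun a b => C τ * Real.exp (-(δ * Dτ τ a b))) := fun τ =>
    (h𝒯 τ).mono fun a b => mul_le_mul_of_nonneg_left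
      (Real.exp_le_exp.mpr (by nlinarith [(hDτ τ).nonneg hd a b])) (hC τ)
  have hK : ∀ p : Wγ × Wτ, HasMaj bF bF (stepOp 𝒢 𝒯 p)
      (fun a b => bP.κ * B p.1 * C p.2 * c * Real.exp (-(δ * infConv (Dγ p.1) (Dτ p.2) a b))) := fun p =>
    hasMaj_comp_walk hd hrow hσ (hB p.1) (hC p.2) hδ hδG (hDγ p.1) (h𝒢 p.1) (h𝒯' p.2)
  have h𝒮' : HasMaj b₀ bF (𝒮 ω) (fun a b => A ω * Real.exp (-(ρ * DS ω a b))) :=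
    (h𝒮 ω).mono fun a b => mul_le_mul_of_nonneg_left
      (Real.exp_le_exp.mpr (by nlinarith [(hDS ω).nonneg hd a b])) (hA ω)
  have hc : 0 ≤ c ∨ IsEmpty g.Site := by
    by_cases hne : Nonempty g.Site
    · exact Or.inl (hrow.nonneg (Classical.arbitrary _))
    · exact Or.inr (not_nonempty_iff.mp hne)
  rcases hc with hc | hemp
  swap
  · intro y' μ hμ y
    exact (IsEmpty.false y).elim
  exact chain_majorant hd hrow hσ
    (fun p => mul_nonneg (mul_nonneg (mul_nonneg bP.κ_nonneg (hB p.1)) (hC p.2)) hc) (hA ω) hρ hρδ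
    (fun p => domBy_infConv htri (hDγ p.1) (hDτ p.2)) hK h𝒮' l

/-- **THEOREM W (i′) — WHERE THE DECAY LIVES.**  The chain distance of a Sect.-D term dominates d, and passes through
every localization visited by ANY factor walk term of any of its steps, and through those visited by its seed — the
decay half of *"depends on configuration U restricted to X̃₀⁵ ∪ … ∪ X̃ₙ⁵"* for the concatenated walk (the
U-dependence half is `B9Locality.Walk.term_dependsOnlyOn`, by name). [cite: Balaban1985BackgroundPropagators, Thm 3.10 p.416 + (3.93) p.410 + (3.154) p.427] -/
theorem sectD_term_through (htri : Triangle254 g) {Dγ : Wγ → g.Site → g.Site → ℝ}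
    {Dτ : Wτ → g.Site → g.Site → ℝ} {DS : WS → g.Site → g.Site → ℝ}
    (hDγ : ∀ γ, DomBy g (Dγ γ)) (hDτ : ∀ τ, DomBy g (Dτ τ)) (hDS : ∀ ω, DomBy g (DS ω))
    (l : List (Wγ × Wτ)) (ω : WS) (X : Set g.Site) :
    DomBy g (chainDist (fun p => infConv (Dγ p.1) (Dτ p.2)) (DS ω) l) ∧
    (Through g (DS ω) X → Through g (chainDist (fun p => infConv (Dγ p.1) (Dτ p.2)) (DS ω) l) X) ∧
    (∀ p ∈ l, (Through g (Dγ p.1) X ∨ Through g (Dτ p.2) X) →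
      Through g (chainDist (fun p => infConv (Dγ p.1) (Dτ p.2)) (DS ω) l) X) := by
  have hD : ∀ p : Wγ × Wτ, DomBy g (infConv (Dγ p.1) (Dτ p.2)) := fun p => domBy_infConv htri (hDγ p.1) (hDτ p.2)
  refine ⟨domBy_chainDist htri hD (hDS ω) l, fun hX => through_chainDist_seed htri hD hX l, ?_⟩
  intro p hp hX
  have hstep : Through g (infConv (Dγ p.1) (Dτ p.2)) X := by
    rcases hX with hX | hX
    · exact through_infConv_left htri hX (hDτ p.2)
    · exact through_infConv_right htri (hDγ p.1) hX
  exact through_chainDist_mem htri hD (hDS ω) hstep l hp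

/-- **THEOREM W (ii), KERNEL-CHECKED — EVERY TRUNCATED SECT.-D EXPANSION HAS THE MAJORANT Ā(1 − q)⁻¹e^{−ρ′d}.**  If the
factor and seed majorant families have uniformly bounded partial sums — Σ_γ m𝒢_γ ≤ B̄e^{−δ′_G d}, Σ_τ m𝒯_τ ≤
C̄e^{−δ′_T d}, Σ_ω m𝒮_ω ≤ Āe^{−ρ′_S d} (the convergence clause of the factors' printed expansions) — and ρ′ + σ ≤
δ′ ≤ δ′_T, δ′ + σ ≤ δ′_G, ρ′ ≤ ρ′_S, q := κ_F(κ_P B̄C̄c)c < 1 (q ∝ the small factor α₀ of Δ′_π: *"each operator Δ′_π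
provides the small factor α₀, which we can choose to be arbitrarily small"*, p. 422), then for EVERY Neumann order
N, every finite set I of step terms and S₀ of seed terms the truncated expansion has the majorant Ā(1 − q)⁻¹e^{−ρ′d} —
uniformly: the expansion converges absolutely in the block norms with the bound of the shape of Theorem 3.12.
[cite: Balaban1985BackgroundPropagators, p.416 (after (3.108)) + p.422 (after (3.131)) + Thm 3.12 p.423; Balaban1984PropagatorsII, Lemma 2.1 p.234] -/
theorem sectD_truncExp_majorant [DecidableEq Wγ] [DecidableEq Wτ] {b₀ : BlockNorm g F₀} {bF : BlockNorm g F}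
    {bP : BlockNorm g P} {𝒢 : Wγ → P →ₗ[ℝ] F} {𝒯 : Wτ → F →ₗ[ℝ] P} {𝒮 : WS → F₀ →ₗ[ℝ] F}
    {m𝒢 : Wγ → g.Site → g.Site → ℝ} {m𝒯 : Wτ → g.Site → g.Site → ℝ} {m𝒮 : WS → g.Site → g.Site → ℝ}
    {Bbar Cbar Abar δG' δT' δ' ρS' ρ' σ c : ℝ}
    (hd : ∀ a b : g.Site, 0 ≤ g.dist a b) (hrow : RowSum g σ c) (hσ : 0 ≤ σ) (htri : Triangle254 g)
    (hBbar : 0 ≤ Bbar) (hCbar : 0 ≤ Cbar) (hAbar : 0 ≤ Abar)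
    (hδ' : 0 ≤ δ') (hδT' : δ' ≤ δT') (hδG' : δ' + σ ≤ δG') (hρ' : 0 ≤ ρ') (hρS' : ρ' ≤ ρS')
    (hρδ' : ρ' + σ ≤ δ')
    (h𝒢nn : ∀ γ a b, 0 ≤ m𝒢 γ a b) (h𝒯nn : ∀ τ a b, 0 ≤ m𝒯 τ a b) (h𝒮nn : ∀ ω a b, 0 ≤ m𝒮 ω a b)
    (h𝒢 : ∀ γ, HasMaj bP bF (𝒢 γ) (m𝒢 γ)) (h𝒯 : ∀ τ, HasMaj bF bP (𝒯 τ) (m𝒯 τ))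
    (h𝒮 : ∀ ω, HasMaj b₀ bF (𝒮 ω) (m𝒮 ω))
    (hG : MajSumLe m𝒢 (fun a b => Bbar * Real.exp (-(δG' * g.dist a b))))
    (hT : MajSumLe m𝒯 (fun a b => Cbar * Real.exp (-(δT' * g.dist a b))))
    (hS : MajSumLe m𝒮 (fun a b => Abar * Real.exp (-(ρS' * g.dist a b))))
    (hq : bF.κ * (bP.κ * Bbar * Cbar * c) * c < 1) (N : ℕ) (I : Finset (Wγ × Wτ)) (S₀ : Finset WS) :
    HasMaj b₀ bF (truncExp (stepOp 𝒢 𝒯) 𝒮 N I S₀)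
      (fun a b => Abar * (1 - bF.κ * (bP.κ * Bbar * Cbar * c) * c)⁻¹ * Real.exp (-(ρ' * g.dist a b))) := by
  have hK : MajSumLe (fun p : Wγ × Wτ => conv bP.κ (m𝒢 p.1) (m𝒯 p.2))
      (fun a b => bP.κ * Bbar * Cbar * c * Real.exp (-(δ' * g.dist a b))) :=
    (MajSumLe.prod bP.κ_nonneg h𝒢nn h𝒯nn hG hT).mono fun a b =>
      conv_exp_shape_le htri hd hrow bP.κ_nonneg hBbar hCbar hδ' hδT' hδG' a b
  have hc : 0 ≤ c ∨ IsEmpty g.Site := by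
    by_cases hne : Nonempty g.Site
    · exact Or.inl (hrow.nonneg (Classical.arbitrary _))
    · exact Or.inr (not_nonempty_iff.mp hne)
  rcases hc with hc | hemp
  swap
  · intro y' μ hμ y
    exact (IsEmpty.false y).elim
  exact truncExp_majorant hd hrow hσ htri
    (mul_nonneg (mul_nonneg (mul_nonneg bP.κ_nonneg hBbar) hCbar) hc) hAbar hρ' hρS' hρδ'
    (fun p a b => conv_nonneg bP.κ_nonneg (h𝒢nn p.1) (h𝒯nn p.2) a b) h𝒮nn
    (fun p => stepOp_hasMaj h𝒢nn h𝒢 h𝒯 p) h𝒮 hK hS hq N I S₀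

/-- **THEOREM W (iii), KERNEL-CHECKED — THE TRUNCATED STEPS CONVERGE TO THE FULL STEP 𝒦 = 𝒢𝒯.**  If the truncated
factors converge in the block seminorms, Σ_{γ∈Iγ_m}𝒢_γ → 𝒢 (with a uniform majorant, e.g. from `MajSumLe`) and
Σ_{τ∈Iτ_m}𝒯_τ → 𝒯, then the step truncations over Iγ_m × Iτ_m converge to 𝒢𝒯 (the operator G₀Δ′_π of (3.130) in the
factored form). [cite: Balaban1985BackgroundPropagators, (3.130) p.421 + p.422 (after (3.131))] -/
theorem sectD_step_cvg {bF : BlockNorm g F} {bP : BlockNorm g P} {𝒢 : Wγ → P →ₗ[ℝ] F} {𝒯 : Wτ → F →ₗ[ℝ] P}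
    {Iγ : ℕ → Finset Wγ} {Iτ : ℕ → Finset Wτ} {𝒢full : P →ₗ[ℝ] F} {𝒯full : F →ₗ[ℝ] P}
    {KbarG : g.Site → g.Site → ℝ} (hG : CvgTo bF (fun m => ∑ γ ∈ Iγ m, 𝒢 γ) 𝒢full)
    (hGmaj : ∀ m, HasMaj bP bF (∑ γ ∈ Iγ m, 𝒢 γ) KbarG) (hKbarG : ∀ a b, 0 ≤ KbarG a b)
    (hT : CvgTo bP (fun m => ∑ τ ∈ Iτ m, 𝒯 τ) 𝒯full) :
    CvgTo bF (fun m => ∑ p ∈ Iγ m ×ˢ Iτ m, stepOp 𝒢 𝒯 p) (𝒢full ∘ₗ 𝒯full) :=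
  (CvgTo.comp hG hGmaj hKbarG hT).congr (fun m μ => by rw [sum_stepOp_product]) fun _ => rfl

/-- **THEOREM W (iv), KERNEL-CHECKED — CONVERGENCE OF THE EXPANSION TO THE NEUMANN PARTIAL SUMS, AND THE LIMIT BOUND.**
With step truncations K_m → 𝒦 (uniform majorant K̄ ≥ 0) and seed truncations S_m → 𝒮: (a) for every N the truncated
expansion of Neumann order N converges, as m → ∞, to Σ_{n<N}𝒦ⁿ𝒮 (`truncExp_eq` + `CvgTo.neumannPartial`); (b) hence
Σ_{n<N}𝒦ⁿ𝒮 inherits the uniform majorant Ā(1 − q)⁻¹e^{−ρ′d} of (ii); (c) if moreover G = 𝒮 + 𝒦G with G a priori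
bounded and 𝒦 majorised by θe^{−δd} (δ ≥ σ, κθc < 1) then G − Σ_{n<N}𝒦ⁿ𝒮 has majorant (κθc)ᴺM₀ → 0
(`neumann_remainder`) and G itself has the majorant Ā(1 − q)⁻¹e^{−ρ′d}: *"From (3.108) it follows that the
expansion … is convergent in all norms … This implies Theorem 3.3"* — here Theorem 3.12's sup/Hölder half, recovered
from the walk expansion. [cite: Balaban1985BackgroundPropagators, p.416 (after (3.108)) + p.422 (after (3.131)) + Thm 3.12 p.423] -/
theorem sectD_limit_majorant [DecidableEq Wγ] [DecidableEq Wτ] {b₀ : BlockNorm g F₀} {bF : BlockNorm g F}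
    {𝒢 : Wγ → P →ₗ[ℝ] F} {𝒯 : Wτ → F →ₗ[ℝ] P} {𝒮 : WS → F₀ →ₗ[ℝ] F}
    {I : ℕ → Finset (Wγ × Wτ)} {S₀ : ℕ → Finset WS} {𝒦 : Module.End ℝ F} {𝒮full G : F₀ →ₗ[ℝ] F}
    {Kbar Kstep : g.Site → g.Site → ℝ} {θ δ σ c M₀ : ℝ}
    (hd : ∀ a b : g.Site, 0 ≤ g.dist a b) (hrow : RowSum g σ c) (hθ : 0 ≤ θ) (hσδ : σ ≤ δ) (hM₀ : 0 ≤ M₀)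
    (hq : bF.κ * θ * c < 1)
    (htrunc : ∀ N m, HasMaj b₀ bF (truncExp (stepOp 𝒢 𝒯) 𝒮 N (I m) (S₀ m)) Kbar)
    (hKcvg : CvgTo bF (fun m => ∑ p ∈ I m, stepOp 𝒢 𝒯 p) 𝒦)
    (hKmaj : ∀ m, HasMaj bF bF (∑ p ∈ I m, stepOp 𝒢 𝒯 p) Kstep) (hKstep : ∀ a b, 0 ≤ Kstep a b)
    (hScvg : CvgTo bF (fun m => ∑ ω ∈ S₀ m, 𝒮 ω) 𝒮full)
    (h𝒦 : HasMaj bF bF 𝒦 (fun a b => θ * Real.exp (-(δ * g.dist a b))))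
    (hfix : G = 𝒮full + 𝒦 ∘ₗ G) (hap : HasMaj b₀ bF G (fun _ _ => M₀)) :
    (∀ N, CvgTo bF (fun m => truncExp (stepOp 𝒢 𝒯) 𝒮 N (I m) (S₀ m))
      (∑ n ∈ Finset.range N, (𝒦 ^ n) ∘ₗ 𝒮full)) ∧
    (∀ N, HasMaj b₀ bF (∑ n ∈ Finset.range N, (𝒦 ^ n) ∘ₗ 𝒮full) Kbar) ∧
    (∀ N, HasMaj b₀ bF (G - ∑ n ∈ Finset.range N, (𝒦 ^ n) ∘ₗ 𝒮full) (fun _ _ => (bF.κ * θ * c) ^ N * M₀)) ∧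
    HasMaj b₀ bF G Kbar := by
  have hcvg : ∀ N, CvgTo bF (fun m => truncExp (stepOp 𝒢 𝒯) 𝒮 N (I m) (S₀ m))
      (∑ n ∈ Finset.range N, (𝒦 ^ n) ∘ₗ 𝒮full) := fun N =>
    (CvgTo.neumannPartial hKcvg hKmaj hKstep hScvg N).congr (fun m μ => by rw [truncExp_eq]) fun _ => rfl
  have hpart : ∀ N, HasMaj b₀ bF (∑ n ∈ Finset.range N, (𝒦 ^ n) ∘ₗ 𝒮full) Kbar := fun N =>
    (hcvg N).hasMaj_of_uniform (htrunc N)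
  have hrem : ∀ N, HasMaj b₀ bF (G - ∑ n ∈ Finset.range N, (𝒦 ^ n) ∘ₗ 𝒮full)
      (fun _ _ => (bF.κ * θ * c) ^ N * M₀) := fun N =>
    neumann_remainder hd hrow hθ hσδ hM₀ h𝒦 hfix hap N
  refine ⟨hcvg, hpart, hrem, ?_⟩
  have hc : 0 ≤ c ∨ IsEmpty g.Site := by
    by_cases hne : Nonempty g.Site
    · exact Or.inl (hrow.nonneg (Classical.arbitrary _))
    · exact Or.inr (not_nonempty_iff.mp hne)
  rcases hc with hc | hemp
  swap
  · intro y' μ hμ y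
    exact (IsEmpty.false y).elim
  have hq0 : 0 ≤ bF.κ * θ * c := mul_nonneg (mul_nonneg bF.κ_nonneg hθ) hc
  refine hasMaj_of_forall_add_pow (M₀ := M₀) hq0 hq fun N => ?_
  have hsum := (hpart N).add (hrem N)
  exact hsum.congr fun μ => by simp

end SectD


end Literature.MathematicalPhysics.QuantumFieldTheory.Balaban1983to89.B9SectDWalk
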